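import Summits.KontsevichZagierPeriods.KontsevichZagierPeriods.Theses.HyperbolicBloch

/-!
# Disproof of `IsometryMove` — crux stmt-KontsevichZagierPeriods-3471 (route HyperbolicBloch, rank 4)

Standing-adversary work file (refuter `cdisprove`, generation 3 / cycle 2). `lean check`: rc 0,
0 `sorry`, 0 warnings; axioms ⊆ {propext, Classical.choice, Quot.sound}. Imports only the route file.

## Verdict: NO KILL — the crux is TRUE (gen-1 sorry-free proof `isometryMove_holds`, attached to the
item as `IsometryMoveProof.lean` + 3-file split for a PROVER to land) and RIGID (every hypothesis and
constant is load-bearing or exactly right, §2–§3, §8). The only refutation channel is soundness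
(`not_equivalent_of_value_ne`); for admissible data the typed `g` is the Poincaré extension of
`w ↦ (aw+b)/(cw+d)` after `(x, y) ↦ (x, εy)`, a hyperbolic isometry with `det Dg = ε (g₃/t)³`
(LEAN THEOREM `JParams.det_M_eq`, §7), so values always agree.

## LANDED in the tree (gen 3) — import these (namespace
`Summit.KontsevichZagierPeriods.HyperbolicBloch.IsometryMoveNegative`, module prefix
`Summits.KontsevichZagierPeriods.KontsevichZagierPeriods.Theorems.IsometryMove.Negative.`):
`Kit` (p70410: §0–§1), `LoadBearing` (p70917: §2), `Tightness` (p70928: §3), `Jacobian` (p70941: §7)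
, `Variants` (p71029: §8–§10, with `gen_of_oneMove` in family form), `QuaternionLineStubs`
(p71037: §5'; + `sandwichDet_holds` appended, p71228 pending) — ALL SIX ACCEPTED. This work file keeps a self-contained copy in its own namespace
until the farm has built them; then it becomes the slim import-based index (`DisproofSlim.lean` in
the refuter folder, ready).

## Index (all sorry-free)
* §0 witness kit; §1 family `IsometryMoveGen Adm height k`, crux = member `(CruxAdm, cruxHeight, 3)`
  (`isometryMove_iff_gen`, definitional), diagonal witnesses, MASTER LEMMA `gen_false_of_diag`.
* §2 LOAD-BEARING: `isometryMove_false_without_det` (`a=b=c=d=0`), `isometryMove_false_without_eps`,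
  `not_isometryMoveAtEps η` ∀ `η ∈ ℚ∖{±1}` + anchor `isometryMove_iff_atEps`.
* §3 TIGHTNESS: `not_isometryMoveHeightScale κ` ∀ `κ ∈ ℚ∖{1}` (+ anchor), `not_isometryMoveUnnormalised`
  (`t/N` without `‖ad−bc‖`), `not_isometryMoveWithExponent k` ∀ `k ≠ 3` (+ anchor), `tightness_instances`.
* §4 NOT load-bearing for truth (documented, no theorem possible): algebraicity, `dom ⊆ {t>0}`.
* §7 POSITIVE BY-PRODUCT, kernel-checked: `det_rank_one_generic`, `JParams.jacobian_reduced`,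
  `JParams.det_M_eq` (`det Dg = ε(g₃/t)³` ∀ real `ε`), `left_inverse_pos/neg` (`g_B ∘ g_A = id`),
  dictionary `den_eq_N`/`num_re_eq_P₁`/`num_im_eq_P₂`/`normSq_det_eq`, `den_pos`, `height_pos`.
  DEAD END: monolithic degree-23 `ring` identity = kernel OOM; factor as in §7.
* §8 (gen 3) more tightness: `not_isometryMoveNormSqHeight` — the slip `normSq (ad−bc)` for
  `‖ad−bc‖` is FALSE (`a = 2`: value × 1/4); NB the slip `conj` on the other factor
  (`conj(aw+b)(cw+d) + conj(a)c t²`) is TRUE (mirror image `y ↦ −y` of `g`, still an isometry) and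
  the sign slip `− a conj(c) t²` needs a `c ≠ 0` witness (image not a box; not attempted).
* §9 (gen 3) the true STRENGTHENING: `IsometryMoveOneMove` (conclusion `of r − of r' ∈
  changeOfVariablesRel`, ONE move) ⇒ crux (`isometryMove_of_oneMove`); this is what line
  `quaternion-difference-quotient` proves; not refutable by evaluation.
* §5' (gen 3) TARGETS = audit of the ACTIVE skeleton `quaternion-difference-quotient` (58ddc11ed261;
  no stub handed over as stuck): all four stubs TRUE; load-bearing hypotheses isolated and PROVED
  necessary: `sandwich_identity` (= `stub_sandwich` (1), in every division ring — copy it),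
  `not_sandwichDet_without_eps` (`stub_sandwichDet` needs `ε = ±1`: `ε = 2`, `E = diag(1,2,1)`),
  `not_model_without_normalisation` (`stub_model` needs `s²(ad−bc) = 1` already for the model
  identity (3): `a = i`: `(iP)1⁻¹ = k ≠ j`); `stub_model` holds for EVERY real `ε`; KEY IDENTITY
  for its conjunct (4) PROVED uniformly in `C`: `moebius_derivFactor : A − (AP+B)(CP+D)⁻¹C = (PC+D)⁻¹`
  (any division ring, `CD = DC`, `AD − BC = 1`) and `norm_derivFactor : ‖A − GC‖‖(CP+D)⁻¹‖ = ‖CP+D‖⁻²`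
  (`= |ad−bc|/N = g₃/t`): conjunct (4) REDUCES to (3) — lead: copy these; AND `sandwichDet_holds`:
  the stub `stub_sandwichDet` itself PROVED VERBATIM (polarization `MᵀM = (‖L‖‖R‖)²·1`; landing as
  p71228 in `Negative/QuaternionLineStubs.lean`; standalone `SandwichDet.lean` attached to the item).
* §10 (gen 3) NON-VACUITY: `cruxHypotheses_satisfiable` (homothety `a = 2`: all hypotheses met by
  box representations of equal positive value).
* §6 Near-misses: none — nothing in this file is sorried.

## For provers / planners
No restatement is needed: `IsometryMove` is correctly typed. A proof must use conformality
`|det Dg| = (g₃/t)³` with the exact factor `‖ad − bc‖/N`; either ONE move (`IsometryMoveOneMove`,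
quaternion line; §7 gives the determinant and the inverse in polynomial form) or the factorisation
`similarity ∘ inversion ∘ similarity` (gen-1 proof, three moves).
-/

noncomputable section

set_option linter.dupNamespace false

open MeasureTheory Set MvPolynomial intervalIntegral
open Literature.NumberTheory.Transcendental Literature.ModelTheory.ExponentialFields

namespace Summit.KontsevichZagierPeriods.KontsevichZagierPeriods.Cruxes.IsometryMove.Disproof

/-! ## §0 Witness kit -/

/-- The density `p ↦ (p 2)^{-k}` on `ℝ³` (`p 2` = height `t`); `k = 3` is the hyperbolic volume
density of the crux. -/
def powDensity (k : ℕ) : (Fin 3 → ℝ) → ℝ := fun p => 1 / p 2 ^ k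

@[simp] theorem powDensity_apply (k : ℕ) (p : Fin 3 → ℝ) : powDensity k p = 1 / p 2 ^ k := rfl

/-- Open coordinate box `∏ᵢ (lᵢ, uᵢ) ⊆ ℝ³`. -/
def box (l u : Fin 3 → ℝ) : Set (Fin 3 → ℝ) := Set.pi univ fun i => Ioo (l i) (u i)

theorem mem_box {l u : Fin 3 → ℝ} {p : Fin 3 → ℝ} :
    p ∈ box l u ↔ ∀ i, l i < p i ∧ p i < u i := by
  simp [box]

theorem pi_univ_eq_biInter (S : Fin 3 → Set ℝ) :
    Set.pi univ S = ⋂ i ∈ (Finset.univ : Finset (Fin 3)), {p : Fin 3 → ℝ | p i ∈ S i} := by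
  ext p; simp

theorem isSemialgebraic_pi (S : Fin 3 → Set ℝ)
    (hS : ∀ i, IsSemialgebraic ℚ {p : Fin 3 → ℝ | p i ∈ S i}) :
    IsSemialgebraic ℚ (Set.pi univ S) := by
  rw [pi_univ_eq_biInter]
  exact IsSemialgebraic.biInter _ _ fun i _ => hS i

theorem isSemialgebraic_coord_Ioo (i : Fin 3) (l u : ℚ) :
    IsSemialgebraic ℚ {p : Fin 3 → ℝ | p i ∈ Ioo (l : ℝ) u} := by
  have h := (isSemialgebraic_setOf_eval_lt (k := ℚ) (R := ℝ) (ι := Fin 3) (C l) (X i)).inter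
    (isSemialgebraic_setOf_eval_lt (k := ℚ) (R := ℝ) (ι := Fin 3) (X i) (C u))
  have hEq : {p : Fin 3 → ℝ | p i ∈ Ioo (l : ℝ) u} =
      {x : Fin 3 → ℝ | aeval x (C l : MvPolynomial (Fin 3) ℚ) < aeval x (X i : MvPolynomial (Fin 3) ℚ)} ∩
      {x : Fin 3 → ℝ | aeval x (X i : MvPolynomial (Fin 3) ℚ) < aeval x (C u : MvPolynomial (Fin 3) ℚ)} := by
    ext p; simp
  rw [hEq]; exact h

theorem isSemialgebraic_coord_singleton (i : Fin 3) (q : ℚ) :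
    IsSemialgebraic ℚ {p : Fin 3 → ℝ | p i ∈ ({(q : ℝ)} : Set ℝ)} := by
  have h := isSemialgebraic_setOf_eval_eq_zero (k := ℚ) (R := ℝ) (ι := Fin 3) (X i - C q)
  have hEq : {p : Fin 3 → ℝ | p i ∈ ({(q : ℝ)} : Set ℝ)} =
      {x : Fin 3 → ℝ | aeval x (X i - C q : MvPolynomial (Fin 3) ℚ) = 0} := by
    ext p; simp [sub_eq_zero]
  rw [hEq]; exact h

/-- Boxes with rational corners are `ℚ`-semialgebraic. -/
theorem isSemialgebraic_box (l u : Fin 3 → ℚ) :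
    IsSemialgebraic ℚ (box (fun i => (l i : ℝ)) (fun i => (u i : ℝ))) :=
  isSemialgebraic_pi _ fun i => isSemialgebraic_coord_Ioo i (l i) (u i)

theorem isSemialgebraicFunOn_powDensity {s : Set (Fin 3 → ℝ)} (hs : IsSemialgebraic ℚ s)
    (h0 : ∀ p ∈ s, p 2 ≠ 0) (k : ℕ) : IsSemialgebraicFunOn ℚ s (powDensity k) := by
  refine (isSemialgebraicFunOn_aeval_div_aeval hs (C 1) (X 2 ^ k) ?_).congr ?_
  · intro p hp; simpa using pow_ne_zero k (h0 p hp)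
  · intro p _; simp

theorem isSemialgebraicFunOn_powDensity_of_eq_zero {s : Set (Fin 3 → ℝ)}
    (hs : IsSemialgebraic ℚ s) (h0 : ∀ p ∈ s, p 2 = 0) {k : ℕ} (hk : k ≠ 0) :
    IsSemialgebraicFunOn ℚ s (powDensity k) := by
  refine (isSemialgebraicFunOn_aeval hs (C 0)).congr ?_
  intro p hp
  simp [h0 p hp, zero_pow hk]

theorem box_subset_Icc (l u : Fin 3 → ℝ) : box l u ⊆ Icc l u :=
  (Set.pi_univ_Ioo_subset l u).trans Ioo_subset_Icc_self

theorem continuousOn_powDensity (k : ℕ) {s : Set (Fin 3 → ℝ)} (h0 : ∀ p ∈ s, p 2 ≠ 0) :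
    ContinuousOn (powDensity k) s :=
  continuousOn_const.div (((continuous_apply 2).pow k).continuousOn)
    fun p hp => pow_ne_zero k (h0 p hp)

/-- `[box l u, t^{-k}]` for a rational box not meeting the plane `t = 0`. -/
def boxRep (k : ℕ) (l u : Fin 3 → ℚ) (h : 0 < l 2 ∨ u 2 < 0) : KZ.IntegralRep 3 where
  domain := box (fun i => (l i : ℝ)) (fun i => (u i : ℝ))
  integrand := powDensity k
  isSemialgebraic_domain := isSemialgebraic_box l u
  isSemialgebraicFunOn_integrand := by
    refine isSemialgebraicFunOn_powDensity (isSemialgebraic_box l u) (fun p hp => ?_) k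
    have h2 := (mem_box.mp hp) 2
    rcases h with h | h
    · exact ne_of_gt (lt_trans (by exact_mod_cast h) h2.1)
    · exact ne_of_lt (lt_trans h2.2 (by exact_mod_cast h))
  integrableOn := by
    refine (ContinuousOn.integrableOn_compact isCompact_Icc
      (continuousOn_powDensity k fun p hp => ?_)).mono_set (box_subset_Icc _ _)
    have h2l : ((l 2 : ℚ) : ℝ) ≤ p 2 := hp.1 2
    have h2u : p 2 ≤ ((u 2 : ℚ) : ℝ) := hp.2 2
    rcases h with h | h
    · exact ne_of_gt (lt_of_lt_of_le (by exact_mod_cast h) h2l)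
    · exact ne_of_lt (lt_of_le_of_lt h2u (by exact_mod_cast h))

@[simp] theorem boxRep_domain (k : ℕ) (l u : Fin 3 → ℚ) (h) :
    (boxRep k l u h).domain = box (fun i => (l i : ℝ)) (fun i => (u i : ℝ)) := rfl

@[simp] theorem boxRep_integrand (k : ℕ) (l u : Fin 3 → ℚ) (h) :
    (boxRep k l u h).integrand = powDensity k := rfl

/-- Fubini on a coordinate box for an integrand depending on the height only. -/
theorem setIntegral_box (l u : Fin 3 → ℝ) (hlu : ∀ i, l i ≤ u i) (φ : ℝ → ℝ) :
    ∫ p in box l u, φ (p 2) = (u 0 - l 0) * (u 1 - l 1) * ∫ t in (l 2)..(u 2), φ t := by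
  have hmeas : MeasurableSet (box l u) := MeasurableSet.univ_pi fun i => measurableSet_Ioo
  let ψ : Fin 3 → ℝ → ℝ := ![fun _ => 1, fun _ => 1, φ]
  let g : Fin 3 → ℝ → ℝ := fun i => (Ioo (l i) (u i)).indicator (ψ i)
  have hind : (box l u).indicator (fun p => φ (p 2)) = fun p => ∏ i, g i (p i) := by
    funext p
    by_cases hp : p ∈ box l u
    · rw [indicator_of_mem hp, Fin.prod_univ_three]
      have h' := mem_box.mp hp
      have e0 : g 0 (p 0) = 1 := indicator_of_mem (s := Ioo (l 0) (u 0)) (h' 0) (ψ 0)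
      have e1 : g 1 (p 1) = 1 := indicator_of_mem (s := Ioo (l 1) (u 1)) (h' 1) (ψ 1)
      have e2 : g 2 (p 2) = φ (p 2) := indicator_of_mem (s := Ioo (l 2) (u 2)) (h' 2) (ψ 2)
      rw [e0, e1, e2]; ring
    · rw [indicator_of_notMem hp]
      have : ∃ i, p i ∉ Ioo (l i) (u i) := by
        by_contra hcon
        push Not at hcon
        exact hp (mem_box.mpr fun i => hcon i)
      obtain ⟨i, hi⟩ := this
      exact (Finset.prod_eq_zero (Finset.mem_univ i)
        (indicator_of_notMem (s := Ioo (l i) (u i)) hi (ψ i))).symm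
  have h0 : ∫ t, g 0 t = u 0 - l 0 := by
    show ∫ t, (Ioo (l 0) (u 0)).indicator (fun _ => (1 : ℝ)) t = _
    rw [MeasureTheory.integral_indicator measurableSet_Ioo, setIntegral_const, smul_eq_mul, mul_one,
      Real.volume_real_Ioo_of_le (hlu 0)]
  have h1 : ∫ t, g 1 t = u 1 - l 1 := by
    show ∫ t, (Ioo (l 1) (u 1)).indicator (fun _ => (1 : ℝ)) t = _
    rw [MeasureTheory.integral_indicator measurableSet_Ioo, setIntegral_const, smul_eq_mul, mul_one,
      Real.volume_real_Ioo_of_le (hlu 1)]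
  have h2 : ∫ t, g 2 t = ∫ t in (l 2)..(u 2), φ t := by
    show ∫ t, (Ioo (l 2) (u 2)).indicator φ t = _
    rw [MeasureTheory.integral_indicator measurableSet_Ioo, ← integral_Ioc_eq_integral_Ioo,
      ← intervalIntegral.integral_of_le (hlu 2)]
  calc ∫ p in box l u, φ (p 2)
      = ∫ p, (box l u).indicator (fun p => φ (p 2)) p := (MeasureTheory.integral_indicator hmeas).symm
    _ = ∫ p : Fin 3 → ℝ, ∏ i, g i (p i) := by rw [hind]
    _ = ∏ i, ∫ t, g i t := integral_fintype_prod_volume_eq_prod g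
    _ = (u 0 - l 0) * (u 1 - l 1) * ∫ t in (l 2)..(u 2), φ t := by
      rw [Fin.prod_univ_three, h0, h1, h2]

theorem value_boxRep (k : ℕ) (l u : Fin 3 → ℚ) (h : 0 < l 2 ∨ u 2 < 0) (hlu : ∀ i, l i ≤ u i) :
    (boxRep k l u h).value =
      ((u 0 : ℝ) - l 0) * ((u 1 : ℝ) - l 1) * ∫ t in (l 2 : ℝ)..(u 2), 1 / t ^ k := by
  have hlu' : ∀ i, (fun i => (l i : ℝ)) i ≤ (fun i => (u i : ℝ)) i := fun i => by
    show (l i : ℝ) ≤ u i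
    exact_mod_cast hlu i
  exact setIntegral_box (fun i => (l i : ℝ)) (fun i => (u i : ℝ)) hlu' (fun t => 1 / t ^ k)

/-- `[s, t^{-k}]` on a Lebesgue-null `ℚ`-semialgebraic set `s` (value `0`). -/
def nullRep (k : ℕ) (s : Set (Fin 3 → ℝ)) (hs : IsSemialgebraic ℚ s)
    (hf : IsSemialgebraicFunOn ℚ s (powDensity k)) (h0 : volume s = 0) : KZ.IntegralRep 3 where
  domain := s
  integrand := powDensity k
  isSemialgebraic_domain := hs
  isSemialgebraicFunOn_integrand := hf
  integrableOn := by
    rw [IntegrableOn, Measure.restrict_eq_zero.mpr h0]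
    exact integrable_zero_measure

@[simp] theorem nullRep_domain (k : ℕ) (s hs hf h0) : (nullRep k s hs hf h0).domain = s := rfl
@[simp] theorem nullRep_integrand (k : ℕ) (s hs hf h0) : (nullRep k s hs hf h0).integrand = powDensity k := rfl

theorem value_nullRep (k : ℕ) (s hs hf h0) : (nullRep k s hs hf h0).value = 0 :=
  setIntegral_measure_zero _ h0

/-- The only refutation channel: the calculus is sound, so inequivalent values forbid `Equivalent`. -/
theorem not_equivalent_of_value_ne {r r' : KZ.IntegralRep 3} (h : r.value ≠ r'.value) :
    ¬ KZ.Equivalent r r' :=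
  fun he => h (KZ.Equivalent.value_eq_holds he)

/-! ### one-variable integrals `∫_a^b t^{-k} dt` -/

theorem intervalIntegrable_powInv (k : ℕ) {a b : ℝ} (h : (0 : ℝ) ∉ uIcc a b) :
    IntervalIntegrable (fun t : ℝ => 1 / t ^ k) volume a b :=
  (continuousOn_const.div (continuousOn_pow k) fun _ ht =>
    pow_ne_zero k fun ht0 => h (ht0 ▸ ht)).intervalIntegrable

theorem integral_powInv_pos (k : ℕ) {a b : ℝ} (ha : 0 < a) (hab : a < b) :
    0 < ∫ t in a..b, 1 / t ^ k := by
  refine intervalIntegral_pos_of_pos_on (intervalIntegrable_powInv k ?_) (fun t ht => ?_) hab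
  · rw [uIcc_of_le hab.le]; exact fun h0 => (lt_irrefl (0 : ℝ)) (lt_of_lt_of_le ha h0.1)
  · have : 0 < t := ha.trans ht.1
    positivity

theorem integral_powInv_scale (k : ℕ) (c a b : ℝ) :
    ∫ t in (c * a)..(c * b), 1 / t ^ k = c * ((1 / c ^ k) * ∫ t in a..b, 1 / t ^ k) := by
  rw [← intervalIntegral.smul_integral_comp_mul_left (f := fun t : ℝ => 1 / t ^ k) c, smul_eq_mul]
  congr 1
  simp_rw [mul_pow, ← one_div_mul_one_div]
  exact intervalIntegral.integral_const_mul _ _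


/-! ## §1 The crux as one member of a parametrised family

`num a b c d ε p` and `den c d ε p` are VERBATIM the numerator and denominator of the typed map of
the crux (`w = p 0 + i ε p 1`, `t = p 2`); `IsometryMoveGen Adm height k` is the crux with
(i) the admissibility hypothesis on `(a,b,c,d,ε)` replaced by `Adm`, (ii) the height numerator
`‖ad − bc‖` replaced by `height a b c d`, (iii) the density exponent `3` replaced by `k`.
`isometryMove_iff_gen` anchors the crux at `Adm = (ad − bc ≠ 0 ∧ ε = ±1)`, `height = ‖ad − bc‖`,
`k = 3`. -/

/-- Numerator of the typed Poincaré extension (verbatim from the crux). -/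
def num (a b c d : ℂ) (ε : ℝ) (p : Fin 3 → ℝ) : ℂ :=
  (a * (Complex.mk (p 0) (ε * p 1)) + b) * (starRingEnd ℂ) (c * (Complex.mk (p 0) (ε * p 1)) + d) +
    a * (starRingEnd ℂ) c * (p 2 : ℂ) ^ 2

/-- Denominator `N = |cw + d|² + |c|² t²` of the typed Poincaré extension (verbatim). -/
def den (c d : ℂ) (ε : ℝ) (p : Fin 3 → ℝ) : ℝ :=
  Complex.normSq (c * (Complex.mk (p 0) (ε * p 1)) + d) + Complex.normSq c * p 2 ^ 2

/-- The admissibility hypothesis of the crux: `ad − bc ≠ 0` and `ε = ±1`. -/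
def CruxAdm (a b c d : ℂ) (ε : ℝ) : Prop := a * d - b * c ≠ 0 ∧ (ε = 1 ∨ ε = -1)

/-- The height numerator of the crux: `‖ad − bc‖`. -/
def cruxHeight (a b c d : ℂ) : ℝ := ‖a * d - b * c‖

/-- The parametrised family around the crux (see the section docstring). -/
def IsometryMoveGen (Adm : ℂ → ℂ → ℂ → ℂ → ℝ → Prop) (height : ℂ → ℂ → ℂ → ℂ → ℝ) (k : ℕ) : Prop :=
  ∀ (a b c d : ℂ) (ε : ℝ), IsAlgebraic ℚ a → IsAlgebraic ℚ b → IsAlgebraic ℚ c → IsAlgebraic ℚ d →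
    Adm a b c d ε →
    ∀ (g : (Fin 3 → ℝ) → (Fin 3 → ℝ)),
      (∀ p, g p = ![(num a b c d ε p).re / den c d ε p, (num a b c d ε p).im / den c d ε p,
        height a b c d * p 2 / den c d ε p]) →
      ∀ (r r' : KZ.IntegralRep 3), r.domain ⊆ {p | 0 < p 2} →
        Set.EqOn r.integrand (powDensity k) r.domain → r'.domain = g '' r.domain →
        Set.EqOn r'.integrand (powDensity k) r'.domain → KZ.Equivalent r r'

/-- ANCHOR: the crux is the member `(CruxAdm, cruxHeight, 3)` of the family (definitional up to
uncurrying `ad − bc ≠ 0 → (ε = 1 ∨ ε = −1) → …`). -/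
theorem isometryMove_iff_gen :
    Theses.HyperbolicBloch.IsometryMove ↔ IsometryMoveGen CruxAdm cruxHeight 3 := by
  constructor
  · intro h a b c d ε ha hb hc hd hadm g hg r r' h1 h2 h3 h4
    exact h a b c d ε ha hb hc hd hadm.1 hadm.2 g hg r r' h1 h2 h3 h4
  · intro h a b c d ε ha hb hc hd hdet heps g hg r r' h1 h2 h3 h4
    exact h a b c d ε ha hb hc hd ⟨hdet, heps⟩ g hg r r' h1 h2 h3 h4

/-! ### the diagonal witnesses `a = α ∈ ℝ`, `b = c = 0`, `d = 1` -/

@[simp] theorem den_diag (ε : ℝ) (p : Fin 3 → ℝ) : den 0 1 ε p = 1 := by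
  simp [den]

@[simp] theorem num_diag (α ε : ℝ) (p : Fin 3 → ℝ) :
    num α 0 0 1 ε p = α * Complex.mk (p 0) (ε * p 1) := by
  simp [num]

@[simp] theorem cruxHeight_diag (α : ℝ) : cruxHeight α 0 0 1 = |α| := by
  simp [cruxHeight]

theorem cruxAdm_diag {α ε : ℝ} (hα : α ≠ 0) (hε : ε = 1 ∨ ε = -1) : CruxAdm α 0 0 1 ε :=
  ⟨by simpa using hα, hε⟩

/-- At the diagonal witnesses the typed map is the diagonal linear map
`diag(α, αε, height)`. -/
theorem formula_diag (α ε h : ℝ) (p : Fin 3 → ℝ) :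
    ![(num α 0 0 1 ε p).re / den 0 1 ε p, (num α 0 0 1 ε p).im / den 0 1 ε p,
        h * p 2 / den 0 1 ε p] = fun i => ![α, α * ε, h] i * p i := by
  ext i
  fin_cases i
  · simp [Complex.mul_re]
  · simp [Complex.mul_im]
    ring
  · simp

/-- The diagonal linear map `p ↦ (Dᵢ pᵢ)ᵢ`. -/
def diagMap (D : Fin 3 → ℝ) : (Fin 3 → ℝ) → (Fin 3 → ℝ) := fun p i => D i * p i

theorem diagMap_image_pi (D : Fin 3 → ℝ) (S : Fin 3 → Set ℝ) :
    diagMap D '' Set.pi univ S = Set.pi univ fun i => (fun t => D i * t) '' S i :=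
  piMap_image_univ_pi (fun i => fun t => D i * t) S

theorem image_mul_left_Ioo_of_neg {c : ℝ} (hc : c < 0) (a b : ℝ) :
    (fun t => c * t) '' Ioo a b = Ioo (c * b) (c * a) := by
  ext x
  constructor
  · rintro ⟨t, ⟨hta, htb⟩, rfl⟩
    exact ⟨mul_lt_mul_of_neg_left htb hc, mul_lt_mul_of_neg_left hta hc⟩
  · rintro ⟨hxb, hxa⟩
    refine ⟨x / c, ⟨?_, ?_⟩, mul_div_cancel₀ x hc.ne⟩
    · rwa [lt_div_iff_of_neg hc, mul_comm]
    · rwa [div_lt_iff_of_neg hc, mul_comm]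

theorem image_mul_left_zero {a b : ℝ} (hab : a < b) :
    (fun t => (0 : ℝ) * t) '' Ioo a b = {0} := by
  simp only [zero_mul]
  exact (nonempty_Ioo.mpr hab).image_const 0

/-- MASTER REFUTATION LEMMA. A member of the family is false as soon as one diagonal witness
`(α, 0, 0, 1, ε)` is admissible and transports some representation `r` (domain in `{t > 0}`,
density `t^{-k}`) to a representation `r'` on the image with a DIFFERENT value: soundness of the
calculus (`KZ.Equivalent.value_eq_holds`) forbids `Equivalent r r'`. -/
theorem gen_false_of_diag {Adm : ℂ → ℂ → ℂ → ℂ → ℝ → Prop} {height : ℂ → ℂ → ℂ → ℂ → ℝ} {k : ℕ}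
    (α ε : ℝ) (hα : IsAlgebraic ℚ (α : ℂ)) (hadm : Adm α 0 0 1 ε)
    (D : Fin 3 → ℝ) (hD : (![α, α * ε, height α 0 0 1] : Fin 3 → ℝ) = D)
    (r r' : KZ.IntegralRep 3) (hdom : r.domain ⊆ {p | 0 < p 2})
    (hint : Set.EqOn r.integrand (powDensity k) r.domain)
    (himg : r'.domain = diagMap D '' r.domain)
    (hint' : Set.EqOn r'.integrand (powDensity k) r'.domain) (hne : r.value ≠ r'.value) :
    ¬ IsometryMoveGen Adm height k := by
  intro hV
  refine not_equivalent_of_value_ne hne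
    (hV α 0 0 1 ε hα isAlgebraic_zero isAlgebraic_zero isAlgebraic_one hadm _ (fun p => rfl)
      r r' hdom hint ?_ hint')
  rw [himg, ← hD]
  congr 1
  funext p
  exact (formula_diag α ε (height α 0 0 1) p).symm

theorem pi_eq_pi {S T : Fin 3 → Set ℝ} (h0 : S 0 = T 0) (h1 : S 1 = T 1) (h2 : S 2 = T 2) :
    Set.pi univ S = Set.pi univ T := by
  have : S = T := by
    funext i
    fin_cases i
    · exact h0
    · exact h1
    · exact h2
  rw [this]

theorem volume_pi_eq_zero {S : Fin 3 → Set ℝ} (i : Fin 3) (hi : volume (S i) = 0) :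
    volume (Set.pi univ S) = 0 := by
  rw [volume_pi_pi]
  exact Finset.prod_eq_zero (Finset.mem_univ i) hi

/-- The reference representation: the unit box `(0,1)² × (1,2)` with density `t^{-k}`. -/
def unitBoxRep (k : ℕ) : KZ.IntegralRep 3 := boxRep k ![0, 0, 1] ![1, 1, 2] (Or.inl (by simp))

theorem unitBoxRep_domain_subset (k : ℕ) : (unitBoxRep k).domain ⊆ {p | 0 < p 2} := by
  intro p hp
  have h2 := (mem_box.mp hp) 2
  have : (1 : ℝ) < p 2 := by simpa using h2.1
  exact lt_trans zero_lt_one this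

theorem value_unitBoxRep (k : ℕ) : (unitBoxRep k).value = ∫ t in (1 : ℝ)..2, 1 / t ^ k := by
  rw [unitBoxRep, value_boxRep k _ _ _ (fun i => by fin_cases i <;> simp)]
  simp

theorem value_unitBoxRep_pos (k : ℕ) : 0 < (unitBoxRep k).value := by
  rw [value_unitBoxRep]
  exact integral_powInv_pos k zero_lt_one one_lt_two


/-! ## §2 Load-bearing hypotheses: `ad − bc ≠ 0` and `ε = ±1`

Each hypothesis `H` of the crux gets `IsometryMoveWithout<H>` (= the family member with `H`
deleted) and a sorry-free `isometryMove_false_without_<H>`: ANY proof of the crux must use `H`. -/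

/-- The crux with the hypothesis `a * d - b * c ≠ 0` DELETED (everything else verbatim). -/
def IsometryMoveWithoutDet : Prop :=
  IsometryMoveGen (fun _ _ _ _ ε => ε = 1 ∨ ε = -1) cruxHeight 3

/-- The crux with the hypothesis `ε = 1 ∨ ε = -1` DELETED (`ε` an arbitrary real). -/
def IsometryMoveWithoutEps : Prop :=
  IsometryMoveGen (fun a b c d _ => a * d - b * c ≠ 0) cruxHeight 3

/-- The crux with `ε = 1 ∨ ε = -1` replaced by `ε = η` for a fixed real `η` (the `η`-slice). -/
def IsometryMoveAtEps (η : ℝ) : Prop :=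
  IsometryMoveGen (fun a b c d ε => a * d - b * c ≠ 0 ∧ ε = η) cruxHeight 3

theorem isometryMove_imp_withoutDet_of (h : IsometryMoveWithoutDet) :
    Theses.HyperbolicBloch.IsometryMove :=
  isometryMove_iff_gen.mpr fun a b c d ε ha hb hc hd hadm => h a b c d ε ha hb hc hd hadm.2

theorem isometryMove_imp_withoutEps_of (h : IsometryMoveWithoutEps) :
    Theses.HyperbolicBloch.IsometryMove :=
  isometryMove_iff_gen.mpr fun a b c d ε ha hb hc hd hadm => h a b c d ε ha hb hc hd hadm.1

theorem withoutEps_imp_atEps (h : IsometryMoveWithoutEps) (η : ℝ) : IsometryMoveAtEps η :=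
  fun a b c d ε ha hb hc hd hadm => h a b c d ε ha hb hc hd hadm.1

/-- ANCHOR: the crux is exactly the conjunction of its two `ε`-slices. -/
theorem isometryMove_iff_atEps :
    Theses.HyperbolicBloch.IsometryMove ↔ (IsometryMoveAtEps 1 ∧ IsometryMoveAtEps (-1)) := by
  rw [isometryMove_iff_gen]
  constructor
  · intro h
    exact ⟨fun a b c d ε ha hb hc hd hadm => h a b c d ε ha hb hc hd ⟨hadm.1, Or.inl hadm.2⟩,
      fun a b c d ε ha hb hc hd hadm => h a b c d ε ha hb hc hd ⟨hadm.1, Or.inr hadm.2⟩⟩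
  · rintro ⟨h1, h2⟩ a b c d ε ha hb hc hd ⟨hdet, hε | hε⟩
    · exact h1 a b c d ε ha hb hc hd ⟨hdet, hε⟩
    · exact h2 a b c d ε ha hb hc hd ⟨hdet, hε⟩

/-- The degenerate point `{0} ⊆ ℝ³` as a (null) representation with density `t⁻³`
(whose Lean value at `t = 0` is `1/0 = 0`). -/
def originRep : KZ.IntegralRep 3 :=
  nullRep 3 (Set.pi univ fun _ => {(0 : ℝ)})
    (isSemialgebraic_pi _ fun i => by simpa using isSemialgebraic_coord_singleton i 0)
    (isSemialgebraicFunOn_powDensity_of_eq_zero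
      (isSemialgebraic_pi _ fun i => by simpa using isSemialgebraic_coord_singleton i 0)
      (fun p hp => by simpa using (mem_univ_pi.mp hp) 2) three_ne_zero)
    (volume_pi_eq_zero 0 (by simp))

/-- **`ad − bc ≠ 0` is load-bearing.** Witness `a = b = c = d = 0`, `ε = 1`: then `N = 0` and the
typed map is `g ≡ 0` (Lean's `x / 0 = 0`), so `g '' σ = {0}` for the unit box `σ`; the transported
representation is null (value `0`) while `∫_σ t⁻³ = 3/8 > 0`. (The same collapse happens for every
rank-one `(a b; c d) ≠ 0`, e.g. `a = b = c = d = 1` gives the constant map `g ≡ (1, 0, 0)`.) -/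
theorem isometryMove_false_without_det : ¬ IsometryMoveWithoutDet := by
  refine gen_false_of_diag 0 1 (by simpa using isAlgebraic_zero) (Or.inl rfl) (fun _ => 0)
    (by funext i; fin_cases i <;> simp [cruxHeight]) (unitBoxRep 3) originRep (unitBoxRep_domain_subset 3)
    (fun _ _ => rfl) ?_ (fun _ _ => rfl) ?_
  · show (Set.pi univ fun _ => {(0 : ℝ)}) = diagMap (fun _ => 0) '' box _ _
    rw [box, diagMap_image_pi]
    refine pi_eq_pi ?_ ?_ ?_ <;> simp
  · rw [show originRep.value = 0 from value_nullRep _ _ _ _ _]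
    exact (value_unitBoxRep_pos 3).ne'

/-- **The `ε`-set `{1, −1}` is exactly right.** For every rational `η ∉ {1, −1}` the `η`-slice is
false. Witness `a = d = 1`, `b = c = 0`, `ε = η`: the typed map is `(x, y, t) ↦ (x, ηy, t)`, which
multiplies the value of the unit box by `|η| ≠ 1` (`η = 0`: collapses it onto a null rectangle). -/
theorem not_isometryMoveAtEps (η : ℚ) (hη1 : η ≠ 1) (hη2 : η ≠ -1) : ¬ IsometryMoveAtEps η := by
  have hI := integral_powInv_pos 3 (zero_lt_one' ℝ) one_lt_two
  rcases lt_trichotomy η 0 with hη | rfl | hη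
  · -- η < 0 : image box (0,1) × (η,0) × (1,2), value (-η)·I
    have hηR : (η : ℝ) < 0 := by exact_mod_cast hη
    refine gen_false_of_diag 1 η (by simpa using isAlgebraic_one) ⟨by simp, rfl⟩ ![1, η, 1]
      (by funext i; fin_cases i <;> simp [cruxHeight]) (unitBoxRep 3)
      (boxRep 3 ![0, η, 1] ![1, 0, 2] (Or.inl (by simp))) (unitBoxRep_domain_subset 3)
      (fun _ _ => rfl) ?_ (fun _ _ => rfl) ?_
    · rw [boxRep_domain, unitBoxRep, boxRep_domain, box, box, diagMap_image_pi]
      refine pi_eq_pi ?_ ?_ ?_ <;> simp [image_mul_left_Ioo_of_neg hηR]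
    · rw [value_unitBoxRep,
        value_boxRep 3 _ _ _ (fun i => by fin_cases i <;> simp [hη.le])]
      simp only [Matrix.cons_val_zero, Matrix.cons_val_one, Matrix.head_cons, Matrix.cons_val_two,
        Matrix.tail_cons, Rat.cast_one, Rat.cast_zero, Rat.cast_ofNat, sub_zero, one_mul, zero_sub]
      intro h
      apply hη2
      have : (-(η : ℝ)) = 1 := (mul_right_cancel₀ hI.ne' (by linarith)).symm
      exact_mod_cast (by linarith : (η : ℝ) = -1)
  · -- η = 0 : image is the null rectangle (0,1) × {0} × (1,2)
    refine gen_false_of_diag 1 0 (by simpa using isAlgebraic_one) ⟨by simp, by simp⟩ ![1, 0, 1]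
      (by funext i; fin_cases i <;> simp [cruxHeight]) (unitBoxRep 3)
      (nullRep 3 (Set.pi univ ![Ioo (0 : ℝ) 1, {0}, Ioo 1 2])
        (isSemialgebraic_pi _ fun i => by
          fin_cases i
          · simpa using isSemialgebraic_coord_Ioo 0 0 1
          · simpa using isSemialgebraic_coord_singleton 1 0
          · simpa using isSemialgebraic_coord_Ioo 2 1 2)
        (isSemialgebraicFunOn_powDensity
          (isSemialgebraic_pi _ fun i => by
            fin_cases i
            · simpa using isSemialgebraic_coord_Ioo 0 0 1
            · simpa using isSemialgebraic_coord_singleton 1 0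
            · simpa using isSemialgebraic_coord_Ioo 2 1 2)
          (fun p hp => by
            have h2 : p 2 ∈ Ioo (1 : ℝ) 2 := by simpa using (mem_univ_pi.mp hp) 2
            exact (zero_lt_one.trans h2.1).ne') 3)
        (volume_pi_eq_zero 1 (by simp)))
      (unitBoxRep_domain_subset 3) (fun _ _ => rfl) ?_ (fun _ _ => rfl) ?_
    · rw [nullRep_domain, unitBoxRep, boxRep_domain, box, diagMap_image_pi]
      refine pi_eq_pi ?_ ?_ ?_ <;> simp
    · rw [value_nullRep]
      exact (value_unitBoxRep_pos 3).ne'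
  · -- 0 < η : image box (0,1) × (0,η) × (1,2), value η·I
    have hηR : (0 : ℝ) < η := by exact_mod_cast hη
    refine gen_false_of_diag 1 η (by simpa using isAlgebraic_one) ⟨by simp, rfl⟩ ![1, η, 1]
      (by funext i; fin_cases i <;> simp [cruxHeight]) (unitBoxRep 3)
      (boxRep 3 ![0, 0, 1] ![1, η, 2] (Or.inl (by simp))) (unitBoxRep_domain_subset 3)
      (fun _ _ => rfl) ?_ (fun _ _ => rfl) ?_
    · rw [boxRep_domain, unitBoxRep, boxRep_domain, box, box, diagMap_image_pi]
      refine pi_eq_pi ?_ ?_ ?_ <;> simp [image_mul_left_Ioo hηR]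
    · rw [value_unitBoxRep,
        value_boxRep 3 _ _ _ (fun i => by fin_cases i <;> simp [hη.le])]
      simp only [Matrix.cons_val_zero, Matrix.cons_val_one, Matrix.head_cons, Matrix.cons_val_two,
        Matrix.tail_cons, Rat.cast_one, Rat.cast_zero, Rat.cast_ofNat, sub_zero, one_mul]
      intro h
      apply hη1
      have : (η : ℝ) = 1 := (mul_right_cancel₀ hI.ne' (by linarith)).symm
      exact_mod_cast this

/-- **`ε = ±1` is load-bearing**: with `ε` unconstrained the statement is false (slice `η = 0`,
or any rational `η ∉ {±1}`, `not_isometryMoveAtEps`). -/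
theorem isometryMove_false_without_eps : ¬ IsometryMoveWithoutEps :=
  fun h => not_isometryMoveAtEps 0 (by norm_num) (by norm_num) (by simpa using withoutEps_imp_atEps h 0)


/-! ## §3 Tightness: the height normalisation `‖ad − bc‖` and the exponent `3` admit no change

Natural strengthenings / mis-formulations, each refuted by a diagonal witness:
* `IsometryMoveHeightScale κ` — height numerator `κ‖ad − bc‖`; true member `κ = 1` (the crux);
  FALSE for every rational `κ ≠ 1` (the conformal factor of a hyperbolic isometry is forced).
* `IsometryMoveUnnormalised` — height numerator `1` (the `SL₂`-normalised textbook formula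
  `t/N` used WITHOUT normalising `ad − bc = 1`); FALSE (witness `a = 2`).
* `IsometryMoveWithExponent k` — density `t^{-k}`; true member `k = 3` (the crux, hyperbolic
  volume `dx dy dt / t³`); FALSE for every `k ≠ 3` (witness: the homothety `a = 2, d = 1`, which
  rescales the value by `2^{3-k}`). -/

/-- The crux with height numerator `κ * ‖a d − b c‖` in place of `‖a d − b c‖`. -/
def IsometryMoveHeightScale (κ : ℝ) : Prop :=
  IsometryMoveGen CruxAdm (fun a b c d => κ * ‖a * d - b * c‖) 3

/-- The crux with height numerator `1` in place of `‖a d − b c‖` (unnormalised `SL₂` formula). -/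
def IsometryMoveUnnormalised : Prop :=
  IsometryMoveGen CruxAdm (fun _ _ _ _ => 1) 3

/-- The crux with density `t^{-k}` in place of `t^{-3}` (on both representations). -/
def IsometryMoveWithExponent (k : ℕ) : Prop :=
  IsometryMoveGen CruxAdm cruxHeight k

/-- ANCHOR: `κ = 1` is the crux. -/
theorem isometryMove_iff_heightScale_one :
    Theses.HyperbolicBloch.IsometryMove ↔ IsometryMoveHeightScale 1 := by
  rw [isometryMove_iff_gen, IsometryMoveHeightScale]
  have : (fun a b c d : ℂ => (1 : ℝ) * ‖a * d - b * c‖) = cruxHeight := by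
    funext a b c d; simp [cruxHeight]
  rw [this]

/-- ANCHOR: `k = 3` is the crux. -/
theorem isometryMove_iff_withExponent_three :
    Theses.HyperbolicBloch.IsometryMove ↔ IsometryMoveWithExponent 3 :=
  isometryMove_iff_gen

/-- **The height normalisation is rigid.** For every rational `κ ≠ 1` the `κ`-scaled statement is
false. Witness `a = d = 1`, `b = c = 0`, `ε = 1`: the typed map is `(x, y, t) ↦ (x, y, κt)`; for
`κ > 0` the unit box `(0,1)² × (1,2)` goes to `(0,1)² × (κ, 2κ)` whose `t⁻³`-value is `κ⁻²` times the
original (substitution `t = κs`); for `κ < 0` the image lies in `{t < 0}` and has negative value; for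
`κ = 0` it is a null square in the plane `t = 0`. -/
theorem not_isometryMoveHeightScale (κ : ℚ) (hκ : κ ≠ 1) : ¬ IsometryMoveHeightScale κ := by
  have hI := integral_powInv_pos 3 (zero_lt_one' ℝ) one_lt_two
  rcases lt_trichotomy κ 0 with hκ0 | rfl | hκ0
  · -- κ < 0 : image (0,1)² × (2κ, κ) ⊆ {t < 0}
    have hκR : (κ : ℝ) < 0 := by exact_mod_cast hκ0
    refine gen_false_of_diag 1 1 (by simpa using isAlgebraic_one)
      (cruxAdm_diag one_ne_zero (Or.inl rfl)) ![1, 1, κ]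
      (by funext i; fin_cases i <;> simp) (unitBoxRep 3)
      (boxRep 3 ![0, 0, 2 * κ] ![1, 1, κ] (Or.inr (by simpa using hκ0)))
      (unitBoxRep_domain_subset 3) (fun _ _ => rfl) ?_ (fun _ _ => rfl) ?_
    · rw [boxRep_domain, unitBoxRep, boxRep_domain, box, box, diagMap_image_pi]
      refine pi_eq_pi ?_ ?_ ?_ <;> simp [image_mul_left_Ioo_of_neg hκR]
      ring_nf
    · rw [value_unitBoxRep,
        value_boxRep 3 _ _ _ (fun i => by fin_cases i <;> simp; linarith)]
      simp only [Matrix.cons_val_zero, Matrix.cons_val_one, Matrix.head_cons, Matrix.cons_val_two,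
        Matrix.tail_cons, Rat.cast_one, Rat.cast_zero, Rat.cast_mul, Rat.cast_ofNat, sub_zero,
        one_mul]
      -- ∫_{2κ}^{κ} = κ · κ⁻³ · ∫_2^1 = -(κ · κ⁻³ · I) < 0 < I
      have hB : ∫ t in (2 * (κ : ℝ))..κ, 1 / t ^ 3 =
          -((κ : ℝ) * (1 / (κ : ℝ) ^ 3 * ∫ t in (1 : ℝ)..2, 1 / t ^ 3)) := by
        have := integral_powInv_scale 3 (κ : ℝ) 2 1
        rw [mul_one, mul_comm (κ : ℝ) 2, intervalIntegral.integral_symm (1 : ℝ) 2] at this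
        rw [this]; ring
      have h3 : (1 : ℝ) / (κ : ℝ) ^ 3 < 0 := by
        rw [one_div_neg]; exact Odd.pow_neg (by decide) hκR
      have : 0 < (κ : ℝ) * (1 / (κ : ℝ) ^ 3 * ∫ t in (1 : ℝ)..2, 1 / t ^ 3) :=
        mul_pos_of_neg_of_neg hκR (mul_neg_of_neg_of_pos h3 hI)
      rw [hB]
      intro h
      linarith
  · -- κ = 0 : image is the null square (0,1)² × {0}
    refine gen_false_of_diag 1 1 (by simpa using isAlgebraic_one)
      (cruxAdm_diag one_ne_zero (Or.inl rfl)) ![1, 1, 0]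
      (by funext i; fin_cases i <;> simp) (unitBoxRep 3)
      (nullRep 3 (Set.pi univ ![Ioo (0 : ℝ) 1, Ioo 0 1, {0}])
        (isSemialgebraic_pi _ fun i => by
          fin_cases i
          · simpa using isSemialgebraic_coord_Ioo 0 0 1
          · simpa using isSemialgebraic_coord_Ioo 1 0 1
          · simpa using isSemialgebraic_coord_singleton 2 0)
        (isSemialgebraicFunOn_powDensity_of_eq_zero
          (isSemialgebraic_pi _ fun i => by
            fin_cases i
            · simpa using isSemialgebraic_coord_Ioo 0 0 1
            · simpa using isSemialgebraic_coord_Ioo 1 0 1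
            · simpa using isSemialgebraic_coord_singleton 2 0)
          (fun p hp => by simpa using (mem_univ_pi.mp hp) 2) three_ne_zero)
        (volume_pi_eq_zero 2 (by simp)))
      (unitBoxRep_domain_subset 3) (fun _ _ => rfl) ?_ (fun _ _ => rfl) ?_
    · rw [nullRep_domain, unitBoxRep, boxRep_domain, box, diagMap_image_pi]
      refine pi_eq_pi ?_ ?_ ?_ <;> simp
    · rw [value_nullRep]
      exact (value_unitBoxRep_pos 3).ne'
  · -- 0 < κ : image (0,1)² × (κ, 2κ)
    have hκR : (0 : ℝ) < κ := by exact_mod_cast hκ0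
    refine gen_false_of_diag 1 1 (by simpa using isAlgebraic_one)
      (cruxAdm_diag one_ne_zero (Or.inl rfl)) ![1, 1, κ]
      (by funext i; fin_cases i <;> simp) (unitBoxRep 3)
      (boxRep 3 ![0, 0, κ] ![1, 1, 2 * κ] (Or.inl (by simpa using hκ0)))
      (unitBoxRep_domain_subset 3) (fun _ _ => rfl) ?_ (fun _ _ => rfl) ?_
    · rw [boxRep_domain, unitBoxRep, boxRep_domain, box, box, diagMap_image_pi]
      refine pi_eq_pi ?_ ?_ ?_ <;> simp [image_mul_left_Ioo hκR]
      ring_nf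
    · rw [value_unitBoxRep,
        value_boxRep 3 _ _ _ (fun i => by fin_cases i <;> simp; linarith)]
      simp only [Matrix.cons_val_zero, Matrix.cons_val_one, Matrix.head_cons, Matrix.cons_val_two,
        Matrix.tail_cons, Rat.cast_one, Rat.cast_zero, Rat.cast_mul, Rat.cast_ofNat, sub_zero,
        one_mul]
      have hB : ∫ t in (κ : ℝ)..(2 * κ), 1 / t ^ 3 =
          (κ : ℝ) * (1 / (κ : ℝ) ^ 3 * ∫ t in (1 : ℝ)..2, 1 / t ^ 3) := by
        have := integral_powInv_scale 3 (κ : ℝ) 1 2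
        rwa [mul_one, mul_comm (κ : ℝ) 2] at this
      rw [hB]
      intro h
      -- I = κ · κ⁻³ · I with I > 0 forces κ³ = κ, i.e. κ = 1 since κ > 0
      have hκ3 : (κ : ℝ) ^ 3 ≠ 0 := pow_ne_zero 3 hκR.ne'
      have hk1 : (1 : ℝ) = (κ : ℝ) * (1 / (κ : ℝ) ^ 3) :=
        mul_right_cancel₀ hI.ne' (by rw [one_mul, mul_assoc]; exact h)
      have e1 : (κ : ℝ) ^ 3 = κ := by
        have := congrArg (· * (κ : ℝ) ^ 3) hk1
        rw [one_mul, mul_assoc, one_div, inv_mul_cancel₀ hκ3, mul_one] at this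
        exact this
      have h5 : ((κ : ℝ) - 1) * ((κ : ℝ) * (κ + 1)) = 0 := by linear_combination e1
      rcases mul_eq_zero.mp h5 with h5 | h5
      · exact hκ (by exact_mod_cast (sub_eq_zero.mp h5))
      · exact absurd h5 (mul_pos hκR (by linarith)).ne'

/-- **The crux is tight in the height numerator:** dropping `‖ad − bc‖` (the unnormalised `SL₂`
formula `t / N`) is false. Witness `a = 2, d = 1, b = c = 0, ε = 1`: the typed map is then
`(x, y, t) ↦ (2x, 2y, t)`, which multiplies the value of the unit box by `4`. -/
theorem not_isometryMoveUnnormalised : ¬ IsometryMoveUnnormalised := by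
  have hI := integral_powInv_pos 3 (zero_lt_one' ℝ) one_lt_two
  refine gen_false_of_diag 2 1 (by simpa using isAlgebraic_nat (R := ℚ) (A := ℂ) 2)
    (cruxAdm_diag two_ne_zero (Or.inl rfl)) ![2, 2, 1]
    (by funext i; fin_cases i <;> simp) (unitBoxRep 3)
    (boxRep 3 ![0, 0, 1] ![2, 2, 2] (Or.inl (by simp)))
    (unitBoxRep_domain_subset 3) (fun _ _ => rfl) ?_ (fun _ _ => rfl) ?_
  · rw [boxRep_domain, unitBoxRep, boxRep_domain, box, box, diagMap_image_pi]
    refine pi_eq_pi ?_ ?_ ?_ <;> simp [image_mul_left_Ioo (zero_lt_two' ℝ)]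
  · rw [value_unitBoxRep, value_boxRep 3 _ _ _ (fun i => by fin_cases i <;> simp)]
    simp only [Matrix.cons_val_zero, Matrix.cons_val_one, Matrix.head_cons, Matrix.cons_val_two,
      Matrix.tail_cons, Rat.cast_one, Rat.cast_zero, Rat.cast_ofNat, sub_zero]
    intro h
    linarith

/-- **The exponent `3` is rigid.** For every `k ≠ 3` the statement with density `t^{-k}` is false.
Witness: the homothety `a = 2, d = 1, b = c = 0, ε = 1`, typed map `p ↦ 2p`, which IS a
hyperbolic isometry; it sends the unit box `(0,1)² × (1,2)` to `(0,2)² × (2,4)` and the value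
`∫ t^{-k}` from `I` to `4 · ∫_2^4 t^{-k} dt = 2^{3-k} I` (substitution `t = 2s`), `I > 0`. -/
theorem not_isometryMoveWithExponent (k : ℕ) (hk : k ≠ 3) : ¬ IsometryMoveWithExponent k := by
  have hI := integral_powInv_pos k (zero_lt_one' ℝ) one_lt_two
  refine gen_false_of_diag 2 1 (by simpa using isAlgebraic_nat (R := ℚ) (A := ℂ) 2)
    (cruxAdm_diag two_ne_zero (Or.inl rfl)) ![2, 2, 2]
    (by funext i; fin_cases i <;> simp [cruxHeight]) (unitBoxRep k)
    (boxRep k ![0, 0, 2] ![2, 2, 4] (Or.inl (by simp)))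
    (unitBoxRep_domain_subset k) (fun _ _ => rfl) ?_ (fun _ _ => rfl) ?_
  · rw [boxRep_domain, unitBoxRep, boxRep_domain, box, box, diagMap_image_pi]
    refine pi_eq_pi ?_ ?_ ?_
    · simp [image_mul_left_Ioo (zero_lt_two' ℝ)]
    · simp [image_mul_left_Ioo (zero_lt_two' ℝ)]
    · simp only [image_mul_left_Ioo (zero_lt_two' ℝ), Matrix.cons_val_two, Matrix.tail_cons,
        Matrix.head_cons, Rat.cast_ofNat]
      norm_num
  · rw [value_unitBoxRep, value_boxRep k _ _ _ (fun i => by fin_cases i <;> norm_num)]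
    simp only [Matrix.cons_val_zero, Matrix.cons_val_one, Matrix.head_cons, Matrix.cons_val_two,
      Matrix.tail_cons, Rat.cast_zero, Rat.cast_ofNat, sub_zero]
    have hB : ∫ t in (2 : ℝ)..4, 1 / t ^ k = 2 * (1 / (2 : ℝ) ^ k * ∫ t in (1 : ℝ)..2, 1 / t ^ k) := by
      have := integral_powInv_scale k (2 : ℝ) 1 2
      rwa [show (2 : ℝ) * 1 = 2 by norm_num, show (2 : ℝ) * 2 = 4 by norm_num] at this
    rw [hB]
    intro h
    -- I = 8 · 2^{-k} · I with I > 0 forces 2^k = 8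
    have h2k : (2 : ℝ) ^ k ≠ 0 := pow_ne_zero k two_ne_zero
    have h' : (2 : ℝ) ^ k * (∫ t in (1 : ℝ)..2, 1 / t ^ k) = 8 * ∫ t in (1 : ℝ)..2, 1 / t ^ k := by
      have e := congrArg (fun x => (2 : ℝ) ^ k * x) h
      rw [e]
      field_simp
      ring
    have h8 : (2 : ℝ) ^ k = 2 ^ 3 := by
      have := mul_right_cancel₀ hI.ne' h'
      rw [this]; norm_num
    exact hk (Nat.pow_right_injective (le_refl 2) (by exact_mod_cast h8))


/-- Named instances of §3 for quick citation: reflecting into the lower half-space (`κ = −1`,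
`t⁻³` is odd so the value changes sign), collapsing the height (`κ = 0`), doubling it (`κ = 2`);
the upper-half-PLANE density `t⁻²` and Lebesgue volume `t⁰` in place of `t⁻³`. -/
theorem tightness_instances :
    ¬ IsometryMoveHeightScale (-1) ∧ ¬ IsometryMoveHeightScale 0 ∧ ¬ IsometryMoveHeightScale 2 ∧
      ¬ IsometryMoveWithExponent 2 ∧ ¬ IsometryMoveWithExponent 0 := by
  refine ⟨?_, ?_, ?_, not_isometryMoveWithExponent 2 (by decide),
    not_isometryMoveWithExponent 0 (by decide)⟩
  · simpa using not_isometryMoveHeightScale (-1) (by norm_num)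
  · simpa using not_isometryMoveHeightScale 0 (by norm_num)
  · simpa using not_isometryMoveHeightScale 2 (by norm_num)

/-! ## §4 Hypotheses that are NOT load-bearing for truth (documentation; no theorem can exist)

* **Algebraicity of `a, b, c, d`.** `IsometryMoveWithoutAlgebraic` below cannot be refuted: for
  EVERY complex `a, b, c, d` with `ad − bc ≠ 0` and `ε = ±1` the typed `g` is a hyperbolic isometry,
  so `value r' = value r` and the soundness channel (`not_equivalent_of_value_ne`) is closed; a
  refutation would need an invariant of `KZ.relations` finer than `KZ.eval`, i.e. a theorem of
  route `Neg` strength. Nor is it provable by the one-move argument: with transcendental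
  coefficients `g` is not `ℚ`-semialgebraic, so `changeOfVariablesRel` does not apply. (The
  hypothesis `r'.domain = g '' r.domain` with `r'` a `ℚ`-semialgebraic representation is then
  rarely satisfiable for full-dimensional `σ`: e.g. for a transcendental translation `w ↦ w + b`
  the image of a rational box is not `ℚ`-semialgebraic; rotation-invariant `σ` with a
  transcendental rotation give `g '' σ = σ`, where `Equivalent r r'` holds by the identity move.)
* **`r.domain ⊆ {0 < p 2}`.** `IsometryMoveWithoutHalfspace` cannot be refuted either: `g` maps
  `{t < 0}` isometrically onto `{t < 0}` (for the measure `|t|⁻³ dp`; `t⁻³` and `g₃⁻³` change sign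
  together), and `σ ∩ {t = 0}` is Lebesgue-null with null image, so values still agree. It is a
  convenience hypothesis for the proof (injectivity and differentiability of `g` fail only on the
  null plane `t = 0` at the pole `w = −d/c`). -/

/-- The crux with the four `IsAlgebraic ℚ _` hypotheses DELETED. Status: neither refutable by
evaluation nor provable by one move (see §4). -/
def IsometryMoveWithoutAlgebraic : Prop :=
  ∀ (a b c d : ℂ) (ε : ℝ), CruxAdm a b c d ε →
    ∀ (g : (Fin 3 → ℝ) → (Fin 3 → ℝ)),
      (∀ p, g p = ![(num a b c d ε p).re / den c d ε p, (num a b c d ε p).im / den c d ε p,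
        cruxHeight a b c d * p 2 / den c d ε p]) →
      ∀ (r r' : KZ.IntegralRep 3), r.domain ⊆ {p | 0 < p 2} →
        Set.EqOn r.integrand (powDensity 3) r.domain → r'.domain = g '' r.domain →
        Set.EqOn r'.integrand (powDensity 3) r'.domain → KZ.Equivalent r r'

/-- The crux with the hypothesis `r.domain ⊆ {p | 0 < p 2}` DELETED. Status: not refutable by
evaluation (see §4); presumably provable with two extra domain-additivity moves (split `σ` along
`t = 0`). -/
def IsometryMoveWithoutHalfspace : Prop :=
  ∀ (a b c d : ℂ) (ε : ℝ), IsAlgebraic ℚ a → IsAlgebraic ℚ b → IsAlgebraic ℚ c → IsAlgebraic ℚ d →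
    CruxAdm a b c d ε →
    ∀ (g : (Fin 3 → ℝ) → (Fin 3 → ℝ)),
      (∀ p, g p = ![(num a b c d ε p).re / den c d ε p, (num a b c d ε p).im / den c d ε p,
        cruxHeight a b c d * p 2 / den c d ε p]) →
      ∀ (r r' : KZ.IntegralRep 3),
        Set.EqOn r.integrand (powDensity 3) r.domain → r'.domain = g '' r.domain →
        Set.EqOn r'.integrand (powDensity 3) r'.domain → KZ.Equivalent r r'

theorem withoutAlgebraic_imp_isometryMove (h : IsometryMoveWithoutAlgebraic) :
    Theses.HyperbolicBloch.IsometryMove :=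
  isometryMove_iff_gen.mpr fun a b c d ε _ _ _ _ hadm => h a b c d ε hadm

theorem withoutHalfspace_imp_isometryMove (h : IsometryMoveWithoutHalfspace) :
    Theses.HyperbolicBloch.IsometryMove :=
  isometryMove_iff_gen.mpr fun a b c d ε ha hb hc hd hadm g hg r r' _ => h a b c d ε ha hb hc hd hadm g hg r r'

/-! ## §5 Targets (lead's stuck stubs): none handed over (`payload.stuck_stubs = []`); the audit of the
ACTIVE skeleton's four stubs is §5' at the end of the file. ## §6 Near-misses: none (nothing sorried). -/

/-! ## §7 Positive by-product for provers: the Jacobian identity, KERNEL-CHECKED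

`det M = ε · |ad − bc|² · N³` where `M_ij = (∂ⱼPᵢ)·N − Pᵢ·(∂ⱼN)` is `N²·` the Jacobian matrix of the
typed map `g = (P₁/N, P₂/N, ‖ad−bc‖·t/N)` with the factor `‖ad − bc‖` taken out of row 3; hence
`det Dg = ‖ad−bc‖ · det M / N⁶ = ε · (‖ad−bc‖/N)³ = ε · (g₃/t)³` for EVERY real `ε` — the move's
integrand condition `t⁻³ = g₃⁻³·|det Dg|` holds iff `|ε| = 1` (cf. `not_isometryMoveAtEps`).
DEAD END recorded: the monolithic identity (degree 23, 3380 monomials) IS closed by `ring` in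
≈ 3 min of elaboration but the KERNEL rejects the proof term ("excessive memory consumption").
The route that type-checks: the rank-one determinant lemma `det(nA − u vᵀ) = n³ det A − n² vᵀadj(A)u`
(generic, 16 letters, `ring`) reduces it to the degree-11 identity `jacobian_reduced` (`ring`,
180 monomials a side), assembled by `linear_combination`. The dictionary with the typed
`num`/`den` is `den_eq_N`, `num_re_eq_P₁`, `num_im_eq_P₂`, `normSq_det_eq`. The nine entries
`P₁x … Nt` ARE the partial derivatives of `P₁, P₂, N` (first-year calculus; checked symbolically in
`compute/jacobian_identity_purepy.py`; the `HasFDerivAt` bookkeeping is left to the prover). -/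

/-- Generic rank-one update of a scaled `3 × 3` determinant:
`det(n·A − u vᵀ) = n³·det A − n²·(vᵀ adj(A) u)`, written out entrywise. -/
theorem det_rank_one_generic (n a11 a12 a13 a21 a22 a23 a31 a32 a33 u1 u2 u3 v1 v2 v3 : ℝ) :
    (a11 * n - u1 * v1) * ((a22 * n - u2 * v2) * (a33 * n - u3 * v3) - (a23 * n - u2 * v3) * (a32 * n - u3 * v2))
      - (a12 * n - u1 * v2) * ((a21 * n - u2 * v1) * (a33 * n - u3 * v3) - (a23 * n - u2 * v3) * (a31 * n - u3 * v1))
      + (a13 * n - u1 * v3) * ((a21 * n - u2 * v1) * (a32 * n - u3 * v2) - (a22 * n - u2 * v2) * (a31 * n - u3 * v1))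
    = n ^ 3 * (a11 * (a22 * a33 - a23 * a32) - a12 * (a21 * a33 - a23 * a31) + a13 * (a21 * a32 - a22 * a31))
      - n ^ 2 * (-(a23 * a32 * u1 * v1) + a23 * a31 * u1 * v2 + a22 * a33 * u1 * v1 - a22 * a31 * u1 * v3
          - a21 * a33 * u1 * v2 + a21 * a32 * u1 * v3 + a13 * a32 * u2 * v1 - a13 * a31 * u2 * v2
          - a13 * a22 * u3 * v1 + a13 * a21 * u3 * v2 - a12 * a33 * u2 * v1 + a12 * a31 * u2 * v3
          + a12 * a23 * u3 * v1 - a12 * a21 * u3 * v3 + a11 * a33 * u2 * v2 - a11 * a32 * u2 * v3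
          - a11 * a23 * u3 * v2 + a11 * a22 * u3 * v3) := by
  ring

/-- The twelve real letters of the Jacobian computation: `a = ar + i ai`, …, `d = dr + i di`,
the point `(x, y, t)` and the reflection parameter `ε`. -/
structure JParams where
  (ar ai br bi cr ci dr di x y t ε : ℝ)

namespace JParams

variable (q : JParams)

/-- `U + iV = a·w + b`, `w = x + iεy`. -/
def U : ℝ := q.ar * q.x - q.ai * (q.ε * q.y) + q.br
/-- `U + iV = a·w + b`. -/
def V : ℝ := q.ai * q.x + q.ar * (q.ε * q.y) + q.bi
/-- `S + iT = c·w + d`. -/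
def S : ℝ := q.cr * q.x - q.ci * (q.ε * q.y) + q.dr
/-- `S + iT = c·w + d`. -/
def T : ℝ := q.ci * q.x + q.cr * (q.ε * q.y) + q.di
/-- `N = |cw + d|² + |c|² t²`. -/
def N : ℝ := q.S ^ 2 + q.T ^ 2 + (q.cr ^ 2 + q.ci ^ 2) * q.t ^ 2
/-- `P₁ = Re((aw+b)·conj(cw+d) + a conj(c) t²)`. -/
def P₁ : ℝ := q.U * q.S + q.V * q.T + (q.ar * q.cr + q.ai * q.ci) * q.t ^ 2
/-- `P₂ = Im((aw+b)·conj(cw+d) + a conj(c) t²)`. -/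
def P₂ : ℝ := q.V * q.S - q.U * q.T + (q.ai * q.cr - q.ar * q.ci) * q.t ^ 2
/-- `∂N/∂x`. -/
def Nx : ℝ := 2 * q.S * q.cr + 2 * q.T * q.ci
/-- `∂N/∂y`. -/
def Ny : ℝ := -(2 * q.S * q.ci * q.ε) + 2 * q.T * q.cr * q.ε
/-- `∂N/∂t`. -/
def Nt : ℝ := 2 * (q.cr ^ 2 + q.ci ^ 2) * q.t
/-- `∂P₁/∂x`. -/
def P₁x : ℝ := q.ar * q.S + q.U * q.cr + q.ai * q.T + q.V * q.ci
/-- `∂P₁/∂y`. -/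
def P₁y : ℝ := -(q.ai * q.ε) * q.S - q.U * (q.ci * q.ε) + q.ar * q.ε * q.T + q.V * (q.cr * q.ε)
/-- `∂P₁/∂t`. -/
def P₁t : ℝ := 2 * (q.ar * q.cr + q.ai * q.ci) * q.t
/-- `∂P₂/∂x`. -/
def P₂x : ℝ := q.ai * q.S + q.V * q.cr - q.ar * q.T - q.U * q.ci
/-- `∂P₂/∂y`. -/
def P₂y : ℝ := q.ar * q.ε * q.S - q.V * (q.ci * q.ε) + q.ai * q.ε * q.T - q.U * (q.cr * q.ε)
/-- `∂P₂/∂t`. -/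
def P₂t : ℝ := 2 * (q.ai * q.cr - q.ar * q.ci) * q.t
/-- `Re(ad − bc)`. -/
def Δre : ℝ := q.ar * q.dr - q.ai * q.di - (q.br * q.cr - q.bi * q.ci)
/-- `Im(ad − bc)`. -/
def Δim : ℝ := q.ar * q.di + q.ai * q.dr - (q.br * q.ci + q.bi * q.cr)

/-- The reduced (degree-11) Jacobian identity: `N·det(∂P) − vᵀ adj(∂P) u = ε |ad − bc|² N` with
`A = ∂P` (third row `(0,0,1)`), `u = (P₁, P₂, t)`, `v = ∇N`. -/
theorem jacobian_reduced :
    q.N * (q.P₁x * q.P₂y - q.P₁y * q.P₂x)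
      - (q.P₂y * q.P₁ * q.Nx - q.P₂x * q.P₁ * q.Ny - q.P₁y * q.P₂ * q.Nx + q.P₁x * q.P₂ * q.Ny
        + q.t * (-(q.P₁t * q.P₂y * q.Nx) + q.P₁t * q.P₂x * q.Ny + q.P₁y * q.P₂t * q.Nx
          - q.P₁y * q.P₂x * q.Nt - q.P₁x * q.P₂t * q.Ny + q.P₁x * q.P₂y * q.Nt))
    = q.ε * (q.Δre ^ 2 + q.Δim ^ 2) * q.N := by
  simp only [N, P₁x, P₂y, P₁y, P₂x, P₁, P₂, Nx, Ny, Nt, P₁t, P₂t, Δre, Δim, U, V, S, T]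
  ring

/-- **The Jacobian identity of the typed Poincaré extension**: with `M_ij = ∂ⱼPᵢ·N − Pᵢ·∂ⱼN`
(`P₃ = t`), `det M = ε·|ad − bc|²·N³`; equivalently `det Dg = ε (g₃/t)³`. -/
theorem det_M_eq :
    (q.P₁x * q.N - q.P₁ * q.Nx) * ((q.P₂y * q.N - q.P₂ * q.Ny) * (1 * q.N - q.t * q.Nt)
        - (q.P₂t * q.N - q.P₂ * q.Nt) * (0 * q.N - q.t * q.Ny))
      - (q.P₁y * q.N - q.P₁ * q.Ny) * ((q.P₂x * q.N - q.P₂ * q.Nx) * (1 * q.N - q.t * q.Nt)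
        - (q.P₂t * q.N - q.P₂ * q.Nt) * (0 * q.N - q.t * q.Nx))
      + (q.P₁t * q.N - q.P₁ * q.Nt) * ((q.P₂x * q.N - q.P₂ * q.Nx) * (0 * q.N - q.t * q.Ny)
        - (q.P₂y * q.N - q.P₂ * q.Ny) * (0 * q.N - q.t * q.Nx))
    = q.ε * (q.Δre ^ 2 + q.Δim ^ 2) * q.N ^ 3 := by
  have hA := det_rank_one_generic q.N q.P₁x q.P₁y q.P₁t q.P₂x q.P₂y q.P₂t 0 0 1 q.P₁ q.P₂ q.t
    q.Nx q.Ny q.Nt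
  have hB := q.jacobian_reduced
  linear_combination hA + q.N ^ 2 * hB

/-! ### Left inverse (injectivity datum), kernel-checked

For second Möbius data `B = (a_B, b_B, c_B, d_B)` (eight real letters `k`) evaluated at the IMAGE
point `g_A(p) = (P₁/N, P₂/N, |Δ| t/N)` with the same `ε`, every quantity of the typed formula is a
polynomial after scaling by a power of `N`: `N·w' = P₁ + iεP₂`, `N²·t'² = |Δ|²t²`,
`N·(c_B w' + d_B) = SB + i TB`, `N²·N_B(g_A p) = NB2`, `N²·num_B(g_A p) = numB2re + i numB2im`.
`left_inverse_pos/neg`: for `B = (d, −b; −c, a)` (`ε = 1`) resp. its complex conjugate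
(`ε = −1`): `NB2 = |Δ|²N`, `numB2re = x|Δ|²N`, `numB2im = y|Δ|²N` — i.e. wherever `N ≠ 0 ≠ N_B`
(all of `{t > 0}`), `g_B(g_A(p)) = (x|Δ|²N/|Δ|²N, y|Δ|²N/|Δ|²N, |Δ|·(|Δ|t/N)/(|Δ|²/N)) = p`:
the typed map is injective on `{t > 0}` with an inverse IN THE SAME TYPED FAMILY (algebraic data). -/

/-- Eight real letters of a second Möbius datum `B`. -/
structure BParams where
  (ar ai br bi cr ci dr di : ℝ)

/-- `Re(N·(c_B w' + d_B))` at the image point. -/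
def SB (k : BParams) : ℝ := k.cr * q.P₁ - k.ci * (q.ε * q.P₂) + k.dr * q.N
/-- `Im(N·(c_B w' + d_B))` at the image point. -/
def TB (k : BParams) : ℝ := k.ci * q.P₁ + k.cr * (q.ε * q.P₂) + k.di * q.N
/-- `N² · N_B(g_A p)`. -/
def NB2 (k : BParams) : ℝ :=
  q.SB k ^ 2 + q.TB k ^ 2 + (k.cr ^ 2 + k.ci ^ 2) * ((q.Δre ^ 2 + q.Δim ^ 2) * q.t ^ 2)
/-- `Re(N·(a_B w' + b_B))`. -/
def AX (k : BParams) : ℝ := k.ar * q.P₁ - k.ai * (q.ε * q.P₂) + k.br * q.N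
/-- `Im(N·(a_B w' + b_B))`. -/
def AY (k : BParams) : ℝ := k.ai * q.P₁ + k.ar * (q.ε * q.P₂) + k.bi * q.N
/-- `Re(N² · num_B(g_A p))`. -/
def numB2re (k : BParams) : ℝ :=
  q.AX k * q.SB k + q.AY k * q.TB k + (k.ar * k.cr + k.ai * k.ci) * ((q.Δre ^ 2 + q.Δim ^ 2) * q.t ^ 2)
/-- `Im(N² · num_B(g_A p))`. -/
def numB2im (k : BParams) : ℝ :=
  q.AY k * q.SB k - q.AX k * q.TB k + (k.ai * k.cr - k.ar * k.ci) * ((q.Δre ^ 2 + q.Δim ^ 2) * q.t ^ 2)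

/-- The inverse datum `B = (d, −b; −c, a)` (for `ε = 1`). -/
def inv : BParams := ⟨q.dr, q.di, -q.br, -q.bi, -q.cr, -q.ci, q.ar, q.ai⟩
/-- The conjugate inverse datum `B̄ = (d̄, −b̄; −c̄, ā)` (for `ε = −1`: `ρ ∘ ext(B) = ext(B̄) ∘ ρ`). -/
def invConj : BParams := ⟨q.dr, -q.di, -q.br, q.bi, -q.cr, q.ci, q.ar, -q.ai⟩

/-- **Left inverse, `ε = 1`:** `g_{(d,−b;−c,a),1} ∘ g_{(a,b;c,d),1} = id` in polynomial form. -/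
theorem left_inverse_pos (h : q.ε = 1) :
    q.NB2 q.inv = (q.Δre ^ 2 + q.Δim ^ 2) * q.N ∧
      q.numB2re q.inv = q.x * (q.Δre ^ 2 + q.Δim ^ 2) * q.N ∧
      q.numB2im q.inv = q.y * (q.Δre ^ 2 + q.Δim ^ 2) * q.N := by
  refine ⟨?_, ?_, ?_⟩ <;>
    simp only [NB2, numB2re, numB2im, SB, TB, AX, AY, inv, N, P₁, P₂, Δre, Δim, U, V, S, T, h] <;>
    ring

/-- **Left inverse, `ε = −1`:** `g_{B̄,−1} ∘ g_{A,−1} = id`, `B̄ = (d̄,−b̄;−c̄,ā)`, in polynomial form. -/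
theorem left_inverse_neg (h : q.ε = -1) :
    q.NB2 q.invConj = (q.Δre ^ 2 + q.Δim ^ 2) * q.N ∧
      q.numB2re q.invConj = q.x * (q.Δre ^ 2 + q.Δim ^ 2) * q.N ∧
      q.numB2im q.invConj = q.y * (q.Δre ^ 2 + q.Δim ^ 2) * q.N := by
  refine ⟨?_, ?_, ?_⟩ <;>
    simp only [NB2, numB2re, numB2im, SB, TB, AX, AY, invConj, N, P₁, P₂, Δre, Δim, U, V, S, T,
      h] <;>
    ring

/-- The parameters of the crux data `(a, b, c, d, ε)` at a point `p`. -/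
def ofCrux (a b c d : ℂ) (ε : ℝ) (p : Fin 3 → ℝ) : JParams :=
  ⟨a.re, a.im, b.re, b.im, c.re, c.im, d.re, d.im, p 0, p 1, p 2, ε⟩

end JParams

/-- Dictionary: the typed denominator is `N`. -/
theorem den_eq_N (a b c d : ℂ) (ε : ℝ) (p : Fin 3 → ℝ) :
    den c d ε p = (JParams.ofCrux a b c d ε p).N := by
  simp [den, JParams.ofCrux, JParams.N, JParams.S, JParams.T, Complex.normSq_apply]
  ring

/-- Dictionary: the real part of the typed numerator is `P₁`. -/
theorem num_re_eq_P₁ (a b c d : ℂ) (ε : ℝ) (p : Fin 3 → ℝ) :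
    (num a b c d ε p).re = (JParams.ofCrux a b c d ε p).P₁ := by
  have h2 : ((p 2 : ℝ) : ℂ) ^ 2 = ((p 2 ^ 2 : ℝ) : ℂ) := by push_cast; ring
  simp only [num, h2]
  simp [-Complex.ofReal_pow, JParams.ofCrux, JParams.P₁, JParams.U, JParams.V, JParams.S, JParams.T,
    Complex.mul_re, Complex.mul_im]
  ring

/-- Dictionary: the imaginary part of the typed numerator is `P₂`. -/
theorem num_im_eq_P₂ (a b c d : ℂ) (ε : ℝ) (p : Fin 3 → ℝ) :
    (num a b c d ε p).im = (JParams.ofCrux a b c d ε p).P₂ := by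
  have h2 : ((p 2 : ℝ) : ℂ) ^ 2 = ((p 2 ^ 2 : ℝ) : ℂ) := by push_cast; ring
  simp only [num, h2]
  simp [-Complex.ofReal_pow, JParams.ofCrux, JParams.P₂, JParams.U, JParams.V, JParams.S, JParams.T,
    Complex.mul_re, Complex.mul_im]
  ring

/-- Dictionary: `|ad − bc|² = Δre² + Δim²` (so `‖ad − bc‖ = √(Δre² + Δim²)`). -/
theorem normSq_det_eq (a b c d : ℂ) (ε : ℝ) (p : Fin 3 → ℝ) :
    Complex.normSq (a * d - b * c) =
      (JParams.ofCrux a b c d ε p).Δre ^ 2 + (JParams.ofCrux a b c d ε p).Δim ^ 2 := by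
  simp [JParams.ofCrux, JParams.Δre, JParams.Δim, Complex.normSq_apply, Complex.mul_re,
    Complex.mul_im]
  ring

/-- `N > 0` on the open upper half-space as soon as `ad − bc ≠ 0` (so all divisions in the typed
formula, in `det_M_eq` and in `left_inverse_pos/neg` are genuine there). -/
theorem den_pos {a b c d : ℂ} (hdet : a * d - b * c ≠ 0) (ε : ℝ) {p : Fin 3 → ℝ}
    (hp : 0 < p 2) : 0 < den c d ε p := by
  unfold den
  by_cases hc : c = 0
  · subst hc
    have hd : d ≠ 0 := by
      rintro rfl
      exact hdet (by ring)
    simpa using Complex.normSq_pos.mpr hd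
  · have h1 : 0 ≤ Complex.normSq (c * (Complex.mk (p 0) (ε * p 1)) + d) := Complex.normSq_nonneg _
    have h2 : 0 < Complex.normSq c * p 2 ^ 2 :=
      mul_pos (Complex.normSq_pos.mpr hc) (pow_pos hp 2)
    linarith

/-- The height `g₃ = ‖ad − bc‖ t / N` of the typed map is positive on `{t > 0}`: `g` preserves the
open upper half-space. -/
theorem height_pos {a b c d : ℂ} (hdet : a * d - b * c ≠ 0) (ε : ℝ) {p : Fin 3 → ℝ}
    (hp : 0 < p 2) : 0 < ‖a * d - b * c‖ * p 2 / den c d ε p :=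
  div_pos (mul_pos (norm_pos_iff.mpr hdet) hp) (den_pos hdet ε hp)

/-! ## §8 (gen 3) More tightness: the `normSq` transcription slip

A plausible mis-transcription of the height numerator is `Complex.normSq (ad − bc) = |ad − bc|²` in
place of `‖ad − bc‖`. It is FALSE (witness `a = 2, d = 1, b = c = 0, ε = 1`: height `4`, typed map
`diag(2, 2, 4)`, value of the unit box multiplied by `2·2·4·4⁻³ = 1/4`). Note this is NOT an
instance of `not_isometryMoveHeightScale` (the scale `|ad − bc|` is data-dependent). -/

/-- The crux with height numerator `|ad − bc|²` (`Complex.normSq`) in place of `‖ad − bc‖`. -/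
def IsometryMoveNormSqHeight : Prop :=
  IsometryMoveGen CruxAdm (fun a b c d => Complex.normSq (a * d - b * c)) 3

/-- **The `normSq` slip is false**: witness `a = 2`, `b = c = 0`, `d = 1`, `ε = 1`. -/
theorem not_isometryMoveNormSqHeight : ¬ IsometryMoveNormSqHeight := by
  have hI := integral_powInv_pos 3 (zero_lt_one' ℝ) one_lt_two
  refine gen_false_of_diag 2 1 (by simpa using isAlgebraic_nat (R := ℚ) (A := ℂ) 2)
    (cruxAdm_diag two_ne_zero (Or.inl rfl)) ![2, 2, 4]
    (by funext i; fin_cases i <;> simp; norm_num) (unitBoxRep 3)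
    (boxRep 3 ![0, 0, 4] ![2, 2, 8] (Or.inl (by simp)))
    (unitBoxRep_domain_subset 3) (fun _ _ => rfl) ?_ (fun _ _ => rfl) ?_
  · rw [boxRep_domain, unitBoxRep, boxRep_domain, box, box, diagMap_image_pi]
    refine pi_eq_pi ?_ ?_ ?_
    · simp [image_mul_left_Ioo (zero_lt_two' ℝ)]
    · simp [image_mul_left_Ioo (zero_lt_two' ℝ)]
    · simp only [image_mul_left_Ioo (zero_lt_four' ℝ), Matrix.cons_val_two, Matrix.tail_cons,
        Matrix.head_cons, Rat.cast_ofNat]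
      norm_num
  · rw [value_unitBoxRep, value_boxRep 3 _ _ _ (fun i => by fin_cases i <;> norm_num)]
    simp only [Matrix.cons_val_zero, Matrix.cons_val_one, Matrix.head_cons, Matrix.cons_val_two,
      Matrix.tail_cons, Rat.cast_zero, Rat.cast_ofNat, sub_zero]
    have hB : ∫ t in (4 : ℝ)..8, 1 / t ^ 3 = 4 * (1 / (4 : ℝ) ^ 3 * ∫ t in (1 : ℝ)..2, 1 / t ^ 3) := by
      have := integral_powInv_scale 3 (4 : ℝ) 1 2
      rwa [show (4 : ℝ) * 1 = 4 by norm_num, show (4 : ℝ) * 2 = 8 by norm_num] at this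
    rw [hB]
    intro h
    rw [show (4 : ℝ) ^ 3 = 64 by norm_num] at h
    linarith

/-! ## §9 (gen 3) The natural STRENGTHENING that is true: one single move

The informal text claims ONE `changeOfVariablesRel` move with `Φ = g`. `IsometryMoveOneMove` is
that literal strengthening (`of r − of r' ∈ changeOfVariablesRel` instead of `Equivalent r r'`);
it implies the crux (`isometryMove_of_oneMove`) and is what the active line
`quaternion-difference-quotient` proves. It is NOT refutable by evaluation (values agree) and we
know no finer invariant of a single move; recorded so that planners may cite the exact target. -/

/-- The crux with conclusion strengthened to a SINGLE change-of-variables move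
`of r - of r' ∈ KZ.changeOfVariablesRel`. -/
def IsometryMoveOneMove : Prop :=
  ∀ (a b c d : ℂ) (ε : ℝ), IsAlgebraic ℚ a → IsAlgebraic ℚ b → IsAlgebraic ℚ c → IsAlgebraic ℚ d →
    CruxAdm a b c d ε →
    ∀ (g : (Fin 3 → ℝ) → (Fin 3 → ℝ)),
      (∀ p, g p = ![(num a b c d ε p).re / den c d ε p, (num a b c d ε p).im / den c d ε p,
        cruxHeight a b c d * p 2 / den c d ε p]) →
      ∀ (r r' : KZ.IntegralRep 3), r.domain ⊆ {p | 0 < p 2} →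
        Set.EqOn r.integrand (powDensity 3) r.domain → r'.domain = g '' r.domain →
        Set.EqOn r'.integrand (powDensity 3) r'.domain → KZ.of r - KZ.of r' ∈ KZ.changeOfVariablesRel

/-- The one-move form implies the crux (a single move is a relation). -/
theorem isometryMove_of_oneMove (h : IsometryMoveOneMove) : Theses.HyperbolicBloch.IsometryMove :=
  isometryMove_iff_gen.mpr fun a b c d ε ha hb hc hd hadm g hg r r' h1 h2 h3 h4 =>
    KZ.changeOfVariablesRel_subset_relations (h a b c d ε ha hb hc hd hadm g hg r r' h1 h2 h3 h4)

/-! ## §5' (gen 3) Targets: audit of the ACTIVE line `quaternion-difference-quotient`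
(skeleton 58ddc11ed261, stubs `stub_semialgebraic`, `stub_model`, `stub_sandwich`, `stub_sandwichDet`;
none handed over as stuck). Verdict per stub, with the load-bearing hypothesis of each isolated:

* `stub_sandwich` (1) — the quaternionic difference-quotient identity — is TRUE in every division
  ring: `sandwich_identity` below (sorry-free, 10 lines; the lead may copy it). (2) `HasFDerivAt` is
  routine from it (or from `hasFDerivAt_ring_inverse`, `ℍ` complete).
* `stub_sandwichDet` is TRUE for `ε = ±1` (the frame `x ↦ LxR` is `‖L‖‖R‖`·orthogonal on `ℍ = ℝ⁴`
  and preserves `span{1,i,j}` by hypothesis, so `E = ‖L‖‖R‖·O·diag(1,ε,1)`); its `ε`-hypothesis is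
  LOAD-BEARING: `not_sandwichDet_without_eps` (`L = R = 1`, `ε = 2`, `E = diag(1,2,1)`, `|det E| = 2`).
* `stub_model` is TRUE, and — notably — for EVERY real `ε` (no `ε = ±1` needed: `ε` only enters
  through `P = x + εy·i + t·j` on both sides). Its normalisation `s²(ad − bc) = 1` is LOAD-BEARING
  already for conjunct (3) (the `k`-component of `(aP+b)(cP+d)⁻¹` is `Im(ad−bc)·t/N`):
  `not_model_without_normalisation` (`a = i, d = 1, b = c = 0`, `p = (0,0,1)`: quaternion side
  `i·j = k`, typed side `j`). KEY IDENTITY for conjunct (4), PROVED here uniformly in `C`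
  (`moebius_derivFactor`, any division ring, needs only `CD = DC` and `AD − BC = 1`):
  `A − (AP+B)(CP+D)⁻¹C = (PC + D)⁻¹`; with `‖PC + D‖ = ‖CP + D‖` (`norm_swap`) this gives
  `norm_derivFactor : ‖A − GC‖·‖(CP+D)⁻¹‖ = ‖CP+D‖⁻²` (`= (|s|²N)⁻¹ = |ad−bc|/N = g₃/t`), i.e.
  `stub_model` (4) REDUCES to (3) plus norm bookkeeping — the lead may copy these three lemmas.
* `stub_semialgebraic` is TRUE (re/im of algebraic numbers are real algebraic, real algebraic
  constants are `ℚ`-definable; closure under field operations and `‖·‖` of a constant). Its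
  algebraicity hypotheses ARE load-bearing for the stub (a transcendental translation `w ↦ w + π`
  has a non-`ℚ`-semialgebraic graph) though not for the truth of the crux (§4); no Lean refutation
  attempted (needs: a `ℚ`-semialgebraic point of `ℝ` is algebraic). -/

/-- `stub_sandwich` (1) holds in every division ring: the quaternionic difference quotient of a
Möbius map. -/
theorem sandwich_identity {K : Type*} [DivisionRing K] (A B C D p q : K)
    (hp : C * p + D ≠ 0) (hq : C * q + D ≠ 0) :
    (A * p + B) * (C * p + D)⁻¹ - (A * q + B) * (C * q + D)⁻¹ =
      (A - (A * q + B) * (C * q + D)⁻¹ * C) * (p - q) * (C * p + D)⁻¹ := by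
  set G := (A * q + B) * (C * q + D)⁻¹ with hG
  have hGq : G * (C * q + D) = A * q + B := by rw [hG, inv_mul_cancel_right₀ hq]
  have hB : B = G * (C * q + D) - A * q := by rw [hGq, add_sub_cancel_left]
  have key : (A - G * C) * (p - q) = (A * p + B) - G * (C * p + D) := by
    rw [hB]; noncomm_ring
  rw [key, sub_mul, mul_inv_cancel_right₀ hp]

/-- **KEY IDENTITY for `stub_model` (4)**, uniform in `C`, in every division ring: for scalars with
`CD = DC` and `AD − BC = 1` (in this order), `A − (AP+B)(CP+D)⁻¹C = (PC + D)⁻¹`. Proof: multiply by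
`PC + D` on the right and use `C(PC + D) = (CP + D)C`. (For `C = 0` it reads `A = D⁻¹`.) -/
theorem moebius_derivFactor {K : Type*} [DivisionRing K] (A B C D P : K)
    (hCD : C * D = D * C) (hdet : A * D - B * C = 1) (hP : C * P + D ≠ 0) :
    A - (A * P + B) * (C * P + D)⁻¹ * C = (P * C + D)⁻¹ := by
  apply eq_inv_of_mul_eq_one_left
  have hY : C * (P * C + D) = (C * P + D) * C := by rw [mul_add, add_mul, hCD, mul_assoc]
  calc (A - (A * P + B) * (C * P + D)⁻¹ * C) * (P * C + D)
      = A * (P * C + D) - (A * P + B) * ((C * P + D)⁻¹ * (C * (P * C + D))) := by noncomm_ring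
    _ = A * (P * C + D) - (A * P + B) * C := by rw [hY, inv_mul_cancel_left₀ hP]
    _ = A * D - B * C := by noncomm_ring
    _ = 1 := hdet

/-- `|PC + D|² = |CP + D|²` for a quaternion `P` and complex `C, D` (`Re(CP·D̄) = Re(P·D̄·C)`). -/
theorem normSq_swap (C D : ℂ) (P : Quaternion ℝ) :
    Quaternion.normSq (P * (C : Quaternion ℝ) + (D : Quaternion ℝ)) =
      Quaternion.normSq ((C : Quaternion ℝ) * P + (D : Quaternion ℝ)) := by
  simp only [Quaternion.normSq_def', Quaternion.re_add, Quaternion.imI_add, Quaternion.imJ_add,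
    Quaternion.imK_add, Quaternion.re_mul, Quaternion.imI_mul, Quaternion.imJ_mul, Quaternion.imK_mul,
    Quaternion.re_coeComplex, Quaternion.imI_coeComplex, Quaternion.imJ_coeComplex,
    Quaternion.imK_coeComplex]
  ring

/-- `‖PC + D‖ = ‖CP + D‖` for a quaternion `P` and complex `C, D`. -/
theorem norm_swap (C D : ℂ) (P : Quaternion ℝ) :
    ‖P * (C : Quaternion ℝ) + (D : Quaternion ℝ)‖ = ‖(C : Quaternion ℝ) * P + (D : Quaternion ℝ)‖ := by
  have h := normSq_swap C D P
  rw [Quaternion.normSq_eq_norm_mul_self, Quaternion.normSq_eq_norm_mul_self] at h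
  nlinarith [norm_nonneg (P * (C : Quaternion ℝ) + (D : Quaternion ℝ)),
    norm_nonneg ((C : Quaternion ℝ) * P + (D : Quaternion ℝ)), h]

/-- **`stub_model` (4) reduces to (3):** for complex `A, B, C, D` with `AD − BC = 1` and a quaternion
`P` with `CP + D ≠ 0`, `‖A − (AP+B)(CP+D)⁻¹C‖ · ‖(CP+D)⁻¹‖ = ‖CP + D‖⁻²` (`= (|s|²N)⁻¹ = |ad−bc|/N =
g₃/t` for the normalised data `A = sa, …` of the stub). -/
theorem norm_derivFactor (A B C D : ℂ) (P : Quaternion ℝ) (hdet : A * D - B * C = 1)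
    (hP : (C : Quaternion ℝ) * P + (D : Quaternion ℝ) ≠ 0) :
    ‖(A : Quaternion ℝ) - ((A : Quaternion ℝ) * P + (B : Quaternion ℝ)) *
          ((C : Quaternion ℝ) * P + (D : Quaternion ℝ))⁻¹ * (C : Quaternion ℝ)‖ *
        ‖((C : Quaternion ℝ) * P + (D : Quaternion ℝ))⁻¹‖ =
      (‖(C : Quaternion ℝ) * P + (D : Quaternion ℝ)‖ ^ 2)⁻¹ := by
  have hdet' : (A : Quaternion ℝ) * (D : Quaternion ℝ) - (B : Quaternion ℝ) * (C : Quaternion ℝ) = 1 := by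
    rw [← Quaternion.coeComplex_mul, ← Quaternion.coeComplex_mul, ← Quaternion.coeComplex_one, ← hdet]
    ext <;> simp
  have hCD : (C : Quaternion ℝ) * (D : Quaternion ℝ) = (D : Quaternion ℝ) * (C : Quaternion ℝ) := by
    rw [← Quaternion.coeComplex_mul, ← Quaternion.coeComplex_mul, mul_comm]
  rw [moebius_derivFactor _ _ _ _ _ hCD hdet' hP, norm_inv, norm_inv, norm_swap, ← mul_inv, sq]

/-- The `ε`-hypothesis of `stub_sandwichDet` is load-bearing: with `ε` free the frame statement is
false (`L = R = 1`, `ε = 2`, `E = diag(1, 2, 1)`: `|det E| = 2 ≠ 1 = (‖L‖‖R‖)³`). -/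
theorem not_sandwichDet_without_eps :
    ¬ ∀ (L R : Quaternion ℝ) (ε : ℝ) (E : (Fin 3 → ℝ) →L[ℝ] (Fin 3 → ℝ)),
      (∀ v : Fin 3 → ℝ, L * ⟨v 0, ε * v 1, v 2, 0⟩ * R = ⟨E v 0, E v 1, E v 2, 0⟩) →
        |E.det| = (‖L‖ * ‖R‖) ^ 3 := by
  intro h
  let D : Fin 3 → ℝ := ![1, 2, 1]
  let E : (Fin 3 → ℝ) →L[ℝ] (Fin 3 → ℝ) :=
    LinearMap.toContinuousLinearMap (Matrix.toLin' (Matrix.diagonal D))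
  have hE : ∀ v : Fin 3 → ℝ, ∀ i, E v i = D i * v i := fun v i => by
    simp [E, Matrix.mulVec_diagonal]
  have hdet : E.det = 2 := by
    simp [E, ContinuousLinearMap.det, Matrix.det_diagonal, Fin.prod_univ_three, D]
  have h1 := h 1 1 2 E (fun v => by
    rw [one_mul, mul_one]
    ext <;> simp [hE, D])
  rw [hdet] at h1
  norm_num at h1

/-- `stub_model` with the normalisation `s² (ad − bc) = 1` weakened to `ad − bc ≠ 0` (and `s = 1`):
the verbatim conjunction for all admissible data. -/
def ModelWithoutNormalisation : Prop :=
  ∀ (a b c d : ℂ) (ε : ℝ), a * d - b * c ≠ 0 →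
    ∀ (g : (Fin 3 → ℝ) → (Fin 3 → ℝ)),
      (∀ p, g p = ![(num a b c d ε p).re / den c d ε p, (num a b c d ε p).im / den c d ε p,
        cruxHeight a b c d * p 2 / den c d ε p]) →
      ∀ (p : Fin 3 → ℝ), 0 < p 2 →
        0 < g p 2 ∧ ((c : ℂ) : Quaternion ℝ) * ⟨p 0, ε * p 1, p 2, 0⟩ + ((d : ℂ) : Quaternion ℝ) ≠ 0 ∧
        (((a : ℂ) : Quaternion ℝ) * ⟨p 0, ε * p 1, p 2, 0⟩ + ((b : ℂ) : Quaternion ℝ)) *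
            (((c : ℂ) : Quaternion ℝ) * ⟨p 0, ε * p 1, p 2, 0⟩ + ((d : ℂ) : Quaternion ℝ))⁻¹ =
          ⟨g p 0, g p 1, g p 2, 0⟩ ∧
        ‖((a : ℂ) : Quaternion ℝ) - ⟨g p 0, g p 1, g p 2, 0⟩ * ((c : ℂ) : Quaternion ℝ)‖ *
            ‖(((c : ℂ) : Quaternion ℝ) * ⟨p 0, ε * p 1, p 2, 0⟩ + ((d : ℂ) : Quaternion ℝ))⁻¹‖ =
          g p 2 / p 2

/-- **The normalisation of `stub_model` is load-bearing** (already for the model identity (3)):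
`a = i`, `d = 1`, `b = c = 0`, `ε = 1`, `p = (0, 0, 1)`: `(iP)(1)⁻¹ = i·j = k` while the typed map
gives `(0, 0, ‖i‖) = j`. -/
theorem not_model_without_normalisation : ¬ ModelWithoutNormalisation := by
  intro h
  have h3 := (h Complex.I 0 0 1 1 (by simp) _ (fun p => rfl) ![0, 0, 1] (by simp)).2.2.1
  have hk := congrArg QuaternionAlgebra.imK h3
  simp only [Quaternion.coeComplex_zero, Quaternion.coeComplex_one, zero_mul, zero_add, add_zero,
    inv_one, mul_one] at hk
  simp [Quaternion.re_coeComplex, Quaternion.imI_coeComplex, Quaternion.imJ_coeComplex,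
    Quaternion.imK_coeComplex] at hk

/-! ## The frame-determinant stub itself, PROVED (gen 3, positive by-product) -/

/-- `stub_sandwichDet` of the active line: a conformal quaternionic frame `v ↦ L·ι_ε(v)·R` that stays in
`span{1,i,j}` has `|det| = (‖L‖‖R‖)³` (`ε = ±1`). Proof: `E` scales the Euclidean quadratic form by
`c² = (‖L‖‖R‖)²` (norm multiplicativity), hence `MᵀM = c²·1` by polarization, `det M² = c⁶`.
This DISCHARGES the stub as registered (skeleton 58ddc11ed261), verbatim. -/
theorem sandwichDet_holds (L R : Quaternion ℝ) (ε : ℝ) (hε : ε = 1 ∨ ε = -1)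
    (E : (Fin 3 → ℝ) →L[ℝ] (Fin 3 → ℝ))
    (hE : ∀ v : Fin 3 → ℝ, L * ⟨v 0, ε * v 1, v 2, 0⟩ * R = ⟨E v 0, E v 1, E v 2, 0⟩) :
    |E.det| = (‖L‖ * ‖R‖) ^ 3 := by
  set c : ℝ := ‖L‖ * ‖R‖ with hc
  have hc0 : 0 ≤ c := mul_nonneg (norm_nonneg _) (norm_nonneg _)
  have hε2 : ε ^ 2 = 1 := by rcases hε with h | h <;> simp [h]
  -- (1) E scales the quadratic form Σ vᵢ² by c²
  have hQ : ∀ v : Fin 3 → ℝ,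
      (E v 0) ^ 2 + (E v 1) ^ 2 + (E v 2) ^ 2 = c ^ 2 * ((v 0) ^ 2 + (v 1) ^ 2 + (v 2) ^ 2) := by
    intro v
    have h := congrArg Quaternion.normSq (hE v)
    rw [map_mul, map_mul, Quaternion.normSq_eq_norm_mul_self L, Quaternion.normSq_eq_norm_mul_self R]
      at h
    simp only [Quaternion.normSq_def'] at h
    have : (E v 0) ^ 2 + (E v 1) ^ 2 + (E v 2) ^ 2 + 0 ^ 2 =
        ‖L‖ * ‖L‖ * ((v 0) ^ 2 + (ε * v 1) ^ 2 + (v 2) ^ 2 + 0 ^ 2) * (‖R‖ * ‖R‖) := h.symm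
    rw [hc]
    linear_combination this + ‖L‖ ^ 2 * ‖R‖ ^ 2 * (v 1) ^ 2 * hε2
  -- (2) polarization: E preserves the dot product up to c²
  have hB : ∀ v w : Fin 3 → ℝ,
      E v 0 * E w 0 + E v 1 * E w 1 + E v 2 * E w 2 = c ^ 2 * (v 0 * w 0 + v 1 * w 1 + v 2 * w 2) := by
    intro v w
    have h1 := hQ (v + w)
    simp only [map_add, Pi.add_apply] at h1
    linear_combination (h1 - hQ v - hQ w) / 2
  -- (3) the matrix of E is c·(orthogonal)
  set M : Matrix (Fin 3) (Fin 3) ℝ := LinearMap.toMatrix' (E : (Fin 3 → ℝ) →ₗ[ℝ] (Fin 3 → ℝ)) with hM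
  have hMe : ∀ i j, M i j = E (Pi.single j 1) i := fun i j => by
    rw [hM, LinearMap.toMatrix'_apply]
    rfl
  have hMM : M.transpose * M = (c ^ 2) • (1 : Matrix (Fin 3) (Fin 3) ℝ) := by
    ext i j
    simp only [Matrix.mul_apply, Matrix.transpose_apply, Fin.sum_univ_three, hMe, Matrix.smul_apply,
      smul_eq_mul]
    rw [hB]
    fin_cases i <;> fin_cases j <;> simp
  -- (4) determinants
  have hdet : E.det = M.det := by
    rw [hM, LinearMap.det_toMatrix']
  have hsq : M.det ^ 2 = (c ^ 3) ^ 2 := by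
    have := congrArg Matrix.det hMM
    rw [Matrix.det_mul, Matrix.det_transpose, Matrix.det_smul, Matrix.det_one, Fintype.card_fin] at this
    linear_combination this
  rw [hdet]
  have h2 : |M.det| ^ 2 = (c ^ 3) ^ 2 := by rw [sq_abs, hsq]
  exact (pow_left_inj₀ (abs_nonneg _) (by positivity) two_ne_zero).mp h2

/-! ## §10 (gen 3) Non-vacuity: the hypotheses of the crux are jointly satisfiable, non-trivially

The crux is not "true for lack of instances": the homothety `a = 2, d = 1, b = c = 0, ε = 1`
(`p ↦ 2p`, a genuine hyperbolic isometry) carries the unit box `(0,1)² × (1,2)` (value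
`∫_1^2 t⁻³ = 3/8 > 0`) onto the box `(0,2)² × (2,4)`, which IS the domain of a representation with
density `t⁻³` and the SAME value (`4 · ∫_2^4 t⁻³ = 3/8`) — consistent with the crux, as it must be. -/

/-- NON-VACUITY of the crux: admissible non-identity data, a representation `r` of positive value and a
representation `r'` on the image with the same value satisfy every hypothesis of `IsometryMove`. -/
theorem cruxHypotheses_satisfiable :
    ∃ (a b c d : ℂ) (ε : ℝ), IsAlgebraic ℚ a ∧ IsAlgebraic ℚ b ∧ IsAlgebraic ℚ c ∧ IsAlgebraic ℚ d ∧
      CruxAdm a b c d ε ∧ a ≠ 1 ∧ ∃ (r r' : KZ.IntegralRep 3), r.domain ⊆ {p | 0 < p 2} ∧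
        Set.EqOn r.integrand (powDensity 3) r.domain ∧
        r'.domain = (fun p => ![(num a b c d ε p).re / den c d ε p, (num a b c d ε p).im / den c d ε p,
          cruxHeight a b c d * p 2 / den c d ε p]) '' r.domain ∧
        Set.EqOn r'.integrand (powDensity 3) r'.domain ∧ 0 < r.value ∧ r'.value = r.value := by
  refine ⟨((2 : ℝ) : ℂ), 0, 0, 1, 1, by simpa using isAlgebraic_nat (R := ℚ) (A := ℂ) 2,
    isAlgebraic_zero, isAlgebraic_zero, isAlgebraic_one, cruxAdm_diag two_ne_zero (Or.inl rfl),
    by norm_num, unitBoxRep 3, boxRep 3 ![0, 0, 2] ![2, 2, 4] (Or.inl (by simp)),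
    unitBoxRep_domain_subset 3, fun _ _ => rfl, ?_, fun _ _ => rfl, value_unitBoxRep_pos 3, ?_⟩
  · have hfun : (fun p => ![(num ((2 : ℝ) : ℂ) 0 0 1 1 p).re / den 0 1 1 p,
        (num ((2 : ℝ) : ℂ) 0 0 1 1 p).im / den 0 1 1 p, cruxHeight ((2 : ℝ) : ℂ) 0 0 1 * p 2 / den 0 1 1 p])
        = diagMap ![2, 2, 2] := by
      funext p
      rw [formula_diag 2 1 (cruxHeight ((2 : ℝ) : ℂ) 0 0 1) p]
      have hD : (![(2 : ℝ), 2 * 1, cruxHeight ((2 : ℝ) : ℂ) 0 0 1] : Fin 3 → ℝ) = ![2, 2, 2] := by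
        funext i; fin_cases i <;> simp [cruxHeight]
      rw [hD]; rfl
    rw [hfun, boxRep_domain, unitBoxRep, boxRep_domain, box, box, diagMap_image_pi]
    refine pi_eq_pi ?_ ?_ ?_
    · simp [image_mul_left_Ioo (zero_lt_two' ℝ)]
    · simp [image_mul_left_Ioo (zero_lt_two' ℝ)]
    · simp only [image_mul_left_Ioo (zero_lt_two' ℝ), Matrix.cons_val_two, Matrix.tail_cons,
        Matrix.head_cons, Rat.cast_ofNat]
      norm_num
  · rw [value_unitBoxRep, value_boxRep 3 _ _ _ (fun i => by fin_cases i <;> norm_num)]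
    simp only [Matrix.cons_val_zero, Matrix.cons_val_one, Matrix.head_cons, Matrix.cons_val_two,
      Matrix.tail_cons, Rat.cast_zero, Rat.cast_ofNat, sub_zero]
    have hB : ∫ t in (2 : ℝ)..4, 1 / t ^ 3 = 2 * (1 / (2 : ℝ) ^ 3 * ∫ t in (1 : ℝ)..2, 1 / t ^ 3) := by
      have := integral_powInv_scale 3 (2 : ℝ) 1 2
      rwa [show (2 : ℝ) * 1 = 2 by norm_num, show (2 : ℝ) * 2 = 4 by norm_num] at this
    rw [hB]
    ring

end Summit.KontsevichZagierPeriods.KontsevichZagierPeriods.Cruxes.IsometryMove.Disproof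

end
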